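import Summits.FinalStateConjecture.FinalStateConjecture.Theses.KerrnessPropagates
import Summits.FinalStateConjecture.FinalStateConjecture.Theorems.KerrnessPropagatesKerrBasinCaptureDefs
import Summits.FinalStateConjecture.FinalStateConjecture.Theorems.KerrnessPropagatesKerrBasinCaptureStubSlabTransferAtTime
import Summits.FinalStateConjecture.FinalStateConjecture.Theorems.KerrnessPropagatesKerrBasinCaptureStubSlabTransferFinal
import Summits.FinalStateConjecture.FinalStateConjecture.Theorems.KerrnessPropagatesKerrBasinCaptureStubMarginCompactness
import Summits.FinalStateConjecture.FinalStateConjecture.Theorems.KerrnessPropagatesKerrBasinCaptureStubLargeNearZones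
import Summits.FinalStateConjecture.FinalStateConjecture.Theorems.KerrnessPropagatesKerrBasinCaptureStubDirectionDodging
import Summits.FinalStateConjecture.FinalStateConjecture.Theorems.KerrnessPropagatesKerrBasinCaptureStubKerrFamilyContinuity
import Summits.FinalStateConjecture.FinalStateConjecture.Theorems.KerrnessPropagatesKerrBasinCaptureStubUniformBoostedKerrDecay
import Summits.FinalStateConjecture.FinalStateConjecture.Theorems.KerrnessPropagatesKerrBasinCaptureStubFarFieldFlatness
import Summits.FinalStateConjecture.FinalStateConjecture.Theorems.KerrnessPropagatesKerrBasinCaptureStubFlatPathExists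
import Summits.FinalStateConjecture.FinalStateConjecture.Theorems.KerrnessPropagatesKerrBasinCaptureStubOrientationTransport
import Summits.FinalStateConjecture.FinalStateConjecture.Theorems.KerrnessPropagatesKerrBasinCaptureStubReanchorMapExists
import Summits.FinalStateConjecture.FinalStateConjecture.Theorems.KerrnessPropagatesKerrBasinCaptureStubReanchorMapShear
import Summits.FinalStateConjecture.FinalStateConjecture.Theorems.KerrnessPropagatesKerrBasinCaptureStubTransferChart
import Literature.Geometry.Lorentzian.TameGenericityDiagonal

/-!
# Skeleton (lead, rev 11) for crux `KerrBasinCapture` (stmt-FinalStateConjecture-17646) of route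
`KerrnessPropagates` — line `registered` (= planner's `Lines/birth.lean`), RESHAPED by the lead.

The crux is the route's ONE generic statement (CAPTURE): for every regularity `k` and every data
manifold `X`, tame-Christodoulou-generically in `admissibleVacuumData X`, every maximal vacuum
Cauchy development (i) has complete `𝓘⁺`, (ii) RECURS to ONE FIXED sub-extremal multi-Kerr
configuration in the one-chart hand-over slab sense, (iii) satisfies the interior lemma.

Cut (unchanged from the birth skeleton): "generic physics | soft geometry of the hand-over format".
* `stub_tameOmegaCapture` (registered, unchanged) — GENERIC ω-LIMIT CAPTURE WITH MARGINS: the open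
  problem (weak cosmic censorship + "ω-limit points of a generic censored development are
  non-degenerate strictly receding multi-Kerr states"), with charges allowed to FLOAT with the
  accuracy inside one compact margin family `(N₀, m₀, χ < 1, μ, v₀, L₀)`.
* the birth skeleton's pointwise `stub_chargeStabilisation` (floating recurrence with margins ⇒
  recurrence to ONE fixed configuration) is now PROVED HERE (`chargeStabilisation_of`) from two
  smaller registered stubs:
  - `stub_marginCompactness` — pure finite-dimensional compactness: a sequence of configurations
    in one margin family has a subsequence with CONSTANT hole count `N` (pigeonhole on `N ≤ N₀`)
    along which masses, spins, inner radii and boosts converge (Bolzano–Weierstrass in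
    `ℝ^{3N} × (E4 →L[ℝ] E4)^N`; the bounded closed piece `‖Λ‖ ≤ L₀` of the Lorentz group is
    compact, the limit is again a Lorentz transformation and the inverses converge too), the limit
    satisfying the (closed) margins. Size M, provable now.
  - `stub_slabTransfer` — the analytic core, stated for a convergent sequence of configurations
    in the margins: for every target accuracy `ε'` there are `n₀`, `ε₀ > 0` such that for every
    `n ≥ n₀`, beyond a time `T = T(n)`, every hand-over slab of the `n`-th configuration at
    accuracy `ε ≤ ε₀` and lab time `τ ≥ T` is re-anchored to a slab of the LIMIT configuration
    (inner radii `lim r₀ + μ/2`, any centres) at accuracy `ε'` and the same `τ`. Proof idea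
    (lead's NOTES.md §T2): per-hole AFFINE Poincaré re-gauging `Θᵢ = Pₙ,ᵢ ∘ Sᵢ ∘ P∞,ᵢ⁻¹`
    (`Sᵢ` a rest-frame time shear, so `Θᵢ` preserves lab time exactly and, by stationarity of
    Kerr–Schild, pulls `Kerrₙ,ᵢ` back to `Kerrₗ,ᵢ` up to `O(‖Λₙ − Λₗ‖ + |Mₙ − Mₗ| + |aₙ − aₗ|)` in
    `Cᵏ` on bounded rest-frame shells), glued to the identity by bumps of width `~v₀τ` (strict
    recession separates the holes by `≥ v₀τ − O(1)`), small `ε` forcing large hypothesis near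
    zones (`Rⱼ ≳ m₀/ε`, Kerr is not flat at its horizon), boosted Kerr–Schild `Cᵏ` decay `O(1/r)`
    for the far field, and transport of the time orientation of `Φ_*∂₀` along nearly flat lab rays.
    Size L–XL; to be cut further into registered pieces as they crystallise.
    Rev 3 (this file) cuts three TRUE, self-contained pieces out of it and registers them:
    `stub_largeNearZones` (T2a: small accuracy forces large hypothesis near zones, uniform in the
    margins, `C⁰` only), `stub_directionDodging` (T2b: pure Euclidean pigeonhole on rays in `E3`),
    `stub_kerrFamilyContinuity` (T2c: `Cᵏ` continuity of the re-anchored Kerr–Schild family on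
    stationary shells — essentially MotionRebase + stationarity), and keeps the remaining core as
    `stub_slabTransferCore : T2a → T2b → T2c → SlabTransfer` (the Θ construction, containments,
    `Cᵏ` bookkeeping under affine/bump precomposition, achronality/J⁺ inheritance, orientation
    transport).
  `chargeStabilisation_of`: choose configurations at accuracies `1/(n+1)`, extract the convergent
  constant-`N` subsequence (stub T1, transported along the `Σ`-type equality), fix the limit
  configuration `pₗ = (N; Mₗ, aₗ, lim r₀ + μ/2; moₗ)` — sub-extremal with `r₀ ∈ (r₋, r₊)` by the
  limit margins — and for accuracy `ε'` and any `τ₁` pick `n ≥ n₀` with `1/(φ n + 1) ≤ ε₀`, then a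
  recurrence time `τ ≥ max τ₁ T` of the `φ n`-th configuration, and transfer (stub T2).
`KerrBasinCapture_of` assembles the crux BY NAME: tame genericity is monotone in the property and
pointwise charge stabilisation turns floating recurrence into the crux's conjunct (ii).
After wave 1 (T1, T2a, T2b, T2c LANDED: p149657, p151854, p152513, p153196) and wave 2 (G p155686, B p156224,
C1 p157304, C2 p156814, A p159821 + Literature/Analysis/Calculus/AffineBumpGluing.lean p158834) sorries live only
in `stub_tameOmegaCapture` (the open problem) and `stub_slabTransferCore2` (the soft assembly).
Rev 11: the soft assembly has LANDED too (Defs p165579, `stub_slabTransferAtTime` p167113, `stub_slabTransferFinal` p167971):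
THE ONLY `sorry` LEFT IS `stub_tameOmegaCapture`, THE OPEN PROBLEM — `KerrBasinCapture_of : Goal.stub_tameOmegaCapture → KerrBasinCapture`. Disproof used: none exists for this crux
(`ledger crux ls`: PICKED.md, Lines/birth.*, 2026-08-17).
Rev 12 (lead c2, 2026-08-17): THE OPEN STUB IS FACTORED LOSSLESSLY THROUGH WEAK COSMIC CENSORSHIP. Tame
genericity is not closed under `∧`, but it COMPOSES ALONG CURVES: given a tame-generic hypothesis `Q`,
tame genericity of `P` is EQUIVALENT to the hand-back "along every tame `Q`-curve of admissible data whose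
base datum is exceptional for `P` there passes a tame, injective, immersed curve of admissible data whose
members off `0` satisfy `P`" (`Literature…InitialDataSet.isTameChristodoulouGeneric_iff_relative_exceptional`,
`TameGenericityDiagonal.lean`). With `Q` := "an MGHD exists and every MGHD has complete `𝓘⁺`" this cuts
`stub_tameOmegaCapture` (now the proved `tameOmegaCapture_of`) into
* `stub_weakCosmicCensorshipTame` — VERBATIM the body of the registered open item
  `Theses.PhaseMixingCapture.WeakCosmicCensorshipTame` (stmt-FinalStateConjecture-17269, crux of route
  `PhaseMixingCapture`; also `PhotonSphereChannels.TameCensorship` ⊇ it): tame weak cosmic censorship — the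
  summit's SHARED open leaf, no longer a private copy inside this crux;
* `stub_captureAlongCensoredCurves` — the route's OWN content, relative form: along every tame curve of
  admissible data whose members off `0` are censored (MGHD exists, complete `𝓘⁺`) and whose base datum is
  exceptional for `Q_k` = complete `𝓘⁺` ∧ floating recurrence with margins ∧ interior lemma, there passes a
  tame injective immersed admissible curve (on some end) whose members off `0` satisfy `Q_k` — "the final
  state, in recurrence form, of CENSORED generic developments".
`tameOmegaCapture_of : stub₁ → stub₂ → TameOmegaCapture` is the tree theorem
`isTameChristodoulouGeneric_of_relative_exceptional`; conversely `captureAlongCensoredCurves_of_tameOmegaCapture :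
TameOmegaCapture → stub₂` (`exists_curve_of_isTameChristodoulouGeneric_of_not`) and TameOmegaCapture ∧ the
route's MGHD item ⇒ stub₁ (`IsTameChristodoulouGeneric.mono`, landed p172189), so the cut neither strengthens
nor weakens the line. `KerrBasinCapture_of : Goal.stub_weakCosmicCensorshipTame →
Goal.stub_captureAlongCensoredCurves → KerrBasinCapture`. Both stubs are open problems; stub₁ IS item 17269.
Rev 13 (lead c2): stub 2 is cut once more along curves, again losslessly, to ISOLATE THE INTERIOR LEMMA:
`stub_recurrenceAlongCensoredCurves` (2a: hand-back of censored-and-recurrent curves along censored curves — the route's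
dynamical conjecture, the final state of censored developments in recurrence form) and
`stub_interiorLemmaAlongRecurrentCurves` (2b: hand-back of `Q_k`-curves along censored-and-recurrent curves — the
interior lemma, generic-only and topology-sensitive since the crux quantifies over ALL one-ended `X`).
`KerrBasinCapture_of : stub 1 → stub 2a → stub 2b → KerrBasinCapture`; sorries 3, all open problems; the rev-12
composition is in the tree (Theorems/KerrnessPropagatesKerrBasinCaptureFromCensorship.lean, p173459).
-/

namespace Summit.FinalStateConjecture.FinalStateConjecture.Cruxes.KerrBasinCapture.Birth

open scoped BigOperators Topology Manifold Classical MeasureTheory ProbabilityTheory Matrix InnerProductSpace ComplexConjugate ContinuousMap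
open Filter Set Function TopologicalSpace MeasureTheory
open Literature.Geometry.Lorentzian
open Summit.FinalStateConjecture.FinalStateConjecture.Theorems.KerrnessPropagates.KerrBasinCapture
  (SlabWith SlabAt InMargins slabAt_iff slabWith_iff inMargins_iff)

/-! ## Building blocks (readable structure; `SlabWith`/`SlabAt`/`InMargins` are the line's TREE definitions, `KerrnessPropagatesKerrBasinCaptureDefs`) -/

section Blocks

variable (k : ℕ) {X : Type} [TopologicalSpace X] [ChartedSpace E3 X] [IsManifold (𝓡 3) (⊤ : ℕ∞) X]
  [ConnectedSpace X] {D : InitialDataSet (𝓡 3) X} (𝒟 : VacuumCauchyDevelopment D)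

/-- RECURRENCE TO ONE FIXED CONFIGURATION (verbatim conjunct (ii) of `KerrBasinCapture`). -/
def FixedRecurrence : Prop :=
  ∃ (N : ℕ) (M a r₀ : Fin N → ℝ) (mo : Fin N → ↥lorentzGroup × E4), (∀ i, Kerr.IsSubextremal (M i) (a i) ∧ r₀ i ∈ Ioo (Kerr.rMinus (M i) (a i)) (Kerr.rPlus (M i) (a i))) ∧ ∀ ε : ℝ, 0 < ε → ∀ τ₁ : ℝ, ∃ τ : ℝ, τ₁ ≤ τ ∧ SlabAt k 𝒟 N M a r₀ mo ε τ

/-- FLOATING RECURRENCE WITH MARGINS: the charges may depend on the accuracy `ε` (not on the time),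
and range in one margin family. -/
def FloatingRecurrence : Prop :=
  ∃ (N₀ : ℕ) (m₀ χ μ v₀ L₀ : ℝ), 0 < m₀ ∧ χ < 1 ∧ 0 < μ ∧ 0 < v₀ ∧ ∀ ε : ℝ, 0 < ε → ∃ (N : ℕ) (M a r₀ : Fin N → ℝ) (mo : Fin N → ↥lorentzGroup × E4), InMargins N₀ m₀ χ μ v₀ L₀ N M a r₀ mo ∧ ∀ τ₁ : ℝ, ∃ τ : ℝ, τ₁ ≤ τ ∧ SlabAt k 𝒟 N M a r₀ mo ε τ

/-- The INTERIOR LEMMA handed over by CAPTURE (verbatim conjunct (iii) of `KerrBasinCapture`). -/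
def InteriorLemma : Prop :=
  ∀ (O : Set 𝒟.carrier) (d : FinalStateDecomposition 𝒟.toSpacetime O 2), (∀ i, Kerr.IsSubextremal (d.mass i) (d.spin i)) → O = Summit.FinalStateConjecture.exteriorOf 𝒟.toCauchyDevelopment d.charted → Summit.FinalStateConjecture.HasExhaustiveCharts d → Summit.FinalStateConjecture.IsFutureOriented d → Summit.FinalStateConjecture.RaysStayInClosure 𝒟.toCauchyDevelopment O

end Blocks

/-- GENERIC ω-LIMIT CAPTURE WITH MARGINS (the birth skeleton's `stub_tameOmegaCapture`; since rev 12 a THEOREM of this file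
modulo the two registered stubs, `tameOmegaCapture_of`). -/
def TameOmegaCapture : Prop :=
  ∀ k : ℕ, ∀ (X : Type) [TopologicalSpace X] [ChartedSpace E3 X] [IsManifold (𝓡 3) (⊤ : ℕ∞) X] [T2Space X] [SecondCountableTopology X] [ConnectedSpace X], InitialDataSet.IsTameChristodoulouGeneric (admissibleVacuumData X) (fun D ↦ ∀ 𝒟 : VacuumCauchyDevelopment D, 𝒟.IsMaximal → Summit.FinalStateConjecture.HasCompleteNullInfinity 𝒟.toCauchyDevelopment ∧ FloatingRecurrence k 𝒟 ∧ InteriorLemma 𝒟) 1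

/-- The CENSORSHIP property of a datum (the property of the registered item
`PhaseMixingCapture.WeakCosmicCensorshipTame`, stmt-FinalStateConjecture-17269): an MGHD exists and every
MGHD has complete future null infinity. -/
def Censored {X : Type} [TopologicalSpace X] [ChartedSpace E3 X] [IsManifold (𝓡 3) (⊤ : ℕ∞) X]
    [ConnectedSpace X] (D : InitialDataSet (𝓡 3) X) : Prop :=
  (∃ 𝒟 : VacuumCauchyDevelopment D, 𝒟.IsMaximal) ∧
    ∀ 𝒟 : VacuumCauchyDevelopment D, 𝒟.IsMaximal → Summit.FinalStateConjecture.HasCompleteNullInfinity 𝒟.toCauchyDevelopment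

/-- The property `Q_k` of `TameOmegaCapture` (complete `𝓘⁺` ∧ floating recurrence with margins ∧ interior
lemma, for every MGHD), as a predicate on data (rev 12). -/
def OmegaCaptured (k : ℕ) {X : Type} [TopologicalSpace X] [ChartedSpace E3 X] [IsManifold (𝓡 3) (⊤ : ℕ∞) X]
    [ConnectedSpace X] (D : InitialDataSet (𝓡 3) X) : Prop :=
  ∀ 𝒟 : VacuumCauchyDevelopment D, 𝒟.IsMaximal →
    Summit.FinalStateConjecture.HasCompleteNullInfinity 𝒟.toCauchyDevelopment ∧ FloatingRecurrence k 𝒟 ∧ InteriorLemma 𝒟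

/-- Statement of `stub_weakCosmicCensorshipTame` (rev 12): TAME WEAK COSMIC CENSORSHIP — verbatim the body of
the registered open item `Theses.PhaseMixingCapture.WeakCosmicCensorshipTame` (stmt-FinalStateConjecture-17269). -/
def WeakCosmicCensorshipTame : Prop :=
  ∀ (X : Type) [TopologicalSpace X] [ChartedSpace E3 X] [IsManifold (𝓡 3) (⊤ : ℕ∞) X] [T2Space X] [SecondCountableTopology X] [ConnectedSpace X], InitialDataSet.IsTameChristodoulouGeneric (admissibleVacuumData X) Censored 1

/-- The property `P₁ k` (rev 13): every MGHD has complete `𝓘⁺` AND recurs with floating charges in one margin family —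
`OmegaCaptured k` without the interior lemma. -/
def CensoredRecurrent (k : ℕ) {X : Type} [TopologicalSpace X] [ChartedSpace E3 X] [IsManifold (𝓡 3) (⊤ : ℕ∞) X]
    [ConnectedSpace X] (D : InitialDataSet (𝓡 3) X) : Prop :=
  ∀ 𝒟 : VacuumCauchyDevelopment D, 𝒟.IsMaximal →
    Summit.FinalStateConjecture.HasCompleteNullInfinity 𝒟.toCauchyDevelopment ∧ FloatingRecurrence k 𝒟

/-- HAND-BACK of `P`-curves along `Q`-curves at `P`-exceptional base data (the relative form of
`TameGenericityDiagonal.lean`, in which a generic hypothesis `Q` enters a generic conclusion `P`; equivalent to tame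
genericity of `P` once `Q` is tame-generic, `isTameChristodoulouGeneric_iff_relative_exceptional`). -/
def HandBack {X : Type} [TopologicalSpace X] [ChartedSpace E3 X] [IsManifold (𝓡 3) (⊤ : ℕ∞) X]
    (Q P : InitialDataSet (𝓡 3) X → Prop) : Prop :=
  ∀ (e : AFEnd X) (F : EuclideanSpace ℝ (Fin 1) → InitialDataSet (𝓡 3) X), InitialDataSet.IsTameDataFamily e 1 F → ((InitialDataSet.IsImmersedAtZero 1 F ∧ Injective F) ∨ ∀ c, F c = F 0) → (∀ c, F c ∈ admissibleVacuumData X) → (∀ c ≠ 0, Q (F c)) → ¬ P (F 0) → ∃ (e' : AFEnd X) (F' : EuclideanSpace ℝ (Fin 1) → InitialDataSet (𝓡 3) X), InitialDataSet.IsTameDataFamily e' 1 F' ∧ F' 0 = F 0 ∧ Injective F' ∧ InitialDataSet.IsImmersedAtZero 1 F' ∧ (∀ c, F' c ∈ admissibleVacuumData X) ∧ ∀ c ≠ 0, P (F' c)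

/-- Statement of `stub_recurrenceAlongCensoredCurves` (rev 13): hand-back of `P₁ k`-curves along censored curves. -/
def RecurrenceAlongCensoredCurves : Prop :=
  ∀ k : ℕ, ∀ (X : Type) [TopologicalSpace X] [ChartedSpace E3 X] [IsManifold (𝓡 3) (⊤ : ℕ∞) X] [T2Space X] [SecondCountableTopology X] [ConnectedSpace X], HandBack (X := X) Censored (CensoredRecurrent k)

/-- Statement of `stub_interiorLemmaAlongRecurrentCurves` (rev 13): hand-back of `Q_k`-curves along `P₁ k`-curves. -/
def InteriorLemmaAlongRecurrentCurves : Prop :=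
  ∀ k : ℕ, ∀ (X : Type) [TopologicalSpace X] [ChartedSpace E3 X] [IsManifold (𝓡 3) (⊤ : ℕ∞) X] [T2Space X] [SecondCountableTopology X] [ConnectedSpace X], HandBack (X := X) (CensoredRecurrent k) (OmegaCaptured k)

/-- CAPTURE ALONG CENSORED CURVES (rev 12's second stub; since rev 13 a theorem modulo stubs 2a, 2b given stub 1,
`captureAlongCensoredCurves_of`): hand-back of `Q_k`-curves along censored curves. -/
def CaptureAlongCensoredCurves : Prop :=
  ∀ k : ℕ, ∀ (X : Type) [TopologicalSpace X] [ChartedSpace E3 X] [IsManifold (𝓡 3) (⊤ : ℕ∞) X] [T2Space X] [SecondCountableTopology X] [ConnectedSpace X], HandBack (X := X) Censored (OmegaCaptured k)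

/-- Statement of `stub_marginCompactness` (COMPACTNESS OF THE MARGIN FAMILY, pure). -/
def MarginCompactness : Prop :=
  ∀ (N₀ : ℕ) (m₀ χ μ v₀ L₀ : ℝ) (s : ℕ → (Σ N : ℕ, (Fin N → ℝ) × (Fin N → ℝ) × (Fin N → ℝ) × (Fin N → ↥lorentzGroup × E4))), (∀ n, InMargins N₀ m₀ χ μ v₀ L₀ (s n).1 (s n).2.1 (s n).2.2.1 (s n).2.2.2.1 (s n).2.2.2.2) → ∃ (N : ℕ) (M a r₀ : ℕ → Fin N → ℝ) (mo : ℕ → Fin N → ↥lorentzGroup × E4) (φ : ℕ → ℕ) (Mₗ aₗ rₗ : Fin N → ℝ) (moₗ : Fin N → ↥lorentzGroup × E4), StrictMono φ ∧ (∀ n, s (φ n) = ⟨N, M n, a n, r₀ n, mo n⟩) ∧ (∀ i, Tendsto (fun n ↦ M n i) atTop (𝓝 (Mₗ i))) ∧ (∀ i, Tendsto (fun n ↦ a n i) atTop (𝓝 (aₗ i))) ∧ (∀ i, Tendsto (fun n ↦ r₀ n i) atTop (𝓝 (rₗ i))) ∧ (∀ i, Tendsto (fun n ↦ (((mo n i).1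 : E4 ≃L[ℝ] E4) : E4 →L[ℝ] E4)) atTop (𝓝 (((moₗ i).1 : E4 ≃L[ℝ] E4) : E4 →L[ℝ] E4))) ∧ (∀ i, Tendsto (fun n ↦ (((mo n i).1 : E4 ≃L[ℝ] E4).symm : E4 →L[ℝ] E4)) atTop (𝓝 (((moₗ i).1 : E4 ≃L[ℝ] E4).symm : E4 →L[ℝ] E4))) ∧ InMargins N₀ m₀ χ μ v₀ L₀ N Mₗ aₗ rₗ moₗ

/-- SLAB TRANSFER (re-anchoring of hand-over slabs to the limit configuration, pointwise in the
development, equation-free) — the conclusion of `stub_slabTransferCore`. -/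
def SlabTransfer : Prop :=
  ∀ k : ℕ, ∀ (X : Type) [TopologicalSpace X] [ChartedSpace E3 X] [IsManifold (𝓡 3) (⊤ : ℕ∞) X] [T2Space X] [SecondCountableTopology X] [ConnectedSpace X] (D : InitialDataSet (𝓡 3) X) (𝒟 : VacuumCauchyDevelopment D) (N₀ : ℕ) (m₀ χ μ v₀ L₀ : ℝ), 0 < m₀ → χ < 1 → 0 < μ → 0 < v₀ → ∀ (N : ℕ) (M a r₀ : ℕ → Fin N → ℝ) (mo : ℕ → Fin N → ↥lorentzGroup × E4) (Mₗ aₗ rₗ r₀ₗ : Fin N → ℝ) (moₗ : Fin N → ↥lorentzGroup × E4), (∀ n, InMargins N₀ m₀ χ μ v₀ L₀ N (M n) (a n) (r₀ n) (mo n)) → (∀ i, Tendsto (fun n ↦ M n i) atTop (𝓝 (Mₗ i))) → (∀ i, Tendsto (fun n ↦ a n i) atTop (𝓝 (aₗ i))) → (∀ i, Tendsto (fun n ↦ r₀ n i) atTop (𝓝 (rₗ i))) → (∀ i, Tendsto (fun n ↦ (((mo n i).1 : E4 ≃L[ℝ] E4) : E4 →L[ℝ] E4)) atTop (𝓝 (((moₗ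 i).1 : E4 ≃L[ℝ] E4) : E4 →L[ℝ] E4))) → (∀ i, Tendsto (fun n ↦ (((mo n i).1 : E4 ≃L[ℝ] E4).symm : E4 →L[ℝ] E4)) atTop (𝓝 (((moₗ i).1 : E4 ≃L[ℝ] E4).symm : E4 →L[ℝ] E4))) → InMargins N₀ m₀ χ μ v₀ L₀ N Mₗ aₗ rₗ moₗ → (∀ i, r₀ₗ i = rₗ i + μ / 2) → ∀ ε' : ℝ, 0 < ε' → ∃ (n₀ : ℕ) (ε₀ : ℝ), 0 < ε₀ ∧ ∀ n, n₀ ≤ n → ∃ T : ℝ, ∀ τ : ℝ, T ≤ τ → ∀ ε : ℝ, 0 < ε → ε ≤ ε₀ → SlabAt k 𝒟 N (M n) (a n) (r₀ n) (mo n) ε τ → SlabAt k 𝒟 N Mₗ aₗ r₀ₗ moₗ ε' τ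

/-- Statement of `stub_largeNearZones` (SMALL ACCURACY FORCES LARGE NEAR ZONES, uniform in the margins). -/
def LargeNearZones : Prop :=
  ∀ k : ℕ, ∀ (X : Type) [TopologicalSpace X] [ChartedSpace E3 X] [IsManifold (𝓡 3) (⊤ : ℕ∞) X] [T2Space X] [SecondCountableTopology X] [ConnectedSpace X] (D : InitialDataSet (𝓡 3) X) (𝒟 : VacuumCauchyDevelopment D) (N₀ : ℕ) (m₀ χ μ v₀ L₀ : ℝ), 0 < m₀ → χ < 1 → 0 < μ → 0 < v₀ → ∀ R₁ : ℝ, ∃ ε₀ : ℝ, 0 < ε₀ ∧ ∀ (N : ℕ) (M a r₀ : Fin N → ℝ) (mo : Fin N → ↥lorentzGroup × E4), InMargins N₀ m₀ χ μ v₀ L₀ N M a r₀ mo → ∃ T : ℝ, ∀ τ : ℝ, T ≤ τ → ∀ ε : ℝ, 0 < ε → ε ≤ ε₀ → ∀ (R : Fin N → ℝ) (U : Opens E4) (Φ : U → 𝒟.carrier), SlabWith k 𝒟 N M a r₀ mo ε τ R U Φ → ∀ j, R₁ ≤ R j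

/-- Statement of `stub_directionDodging` (a ray from a point far from `N` balls misses all of them,
for one of `N + 1` well-separated directions; pure Euclidean geometry of `E3`). -/
def DirectionDodging : Prop :=
  ∀ (N : ℕ) (X : Fin N → E3) (z : E3) (ρ D : ℝ), 0 < ρ → 32 * ((N : ℝ) + 1) * ρ ≤ D → (∀ i, D ≤ ‖z - X i‖) → ∃ e : E3, ‖e‖ = 1 ∧ ∀ i, ∀ s : ℝ, 0 ≤ s → ρ ≤ ‖z + s • e - X i‖

/-- Statement of `stub_kerrFamilyContinuity` (continuity of the re-anchored Kerr–Schild family in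
labels and frame, in `Cᵏ`, uniformly on stationary shells of the limit hole). -/
def KerrFamilyContinuity : Prop :=
  ∀ (k : ℕ) (Mseq aseq : ℕ → ℝ) (Tseq : ℕ → E4 →L[ℝ] E4) (Mₗ aₗ : ℝ) (Λₗ : ↥lorentzGroup) (cₗ : E4) (ρ₁ ρ₂ : ℝ), 0 < ρ₁ → Tendsto Mseq atTop (𝓝 Mₗ) → Tendsto aseq atTop (𝓝 aₗ) → Tendsto Tseq atTop (𝓝 ((Λₗ : E4 ≃L[ℝ] E4).symm : E4 →L[ℝ] E4)) → (∀ n, ∃ κ : ℝ, Tseq n ((Λₗ : E4 ≃L[ℝ] E4) (E4.basisVector 0)) = κ • E4.basisVector 0) → ∀ δ : ℝ, 0 < δ → ∀ᶠ n in atTop, ∀ i ≤ k, ∀ x : E4, ρ₁ ≤ Kerr.radius aₗ (poincareInv Λₗ cₗ x) → Kerr.radius aₗ (poincareInv Λₗ cₗ x) ≤ ρ₂ → ‖iteratedFDeriv ℝ i (fun z ↦ (ContinuousLinearMap.precomp ℝ (Tseq n)).comp ((Kerr.bilin (Mseq n) (aseq n) (Tseq n (z - cₗ))).comp (Tseq n)))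 x - iteratedFDeriv ℝ i (boostedKerrBilin Λₗ cₗ Mₗ aₗ) x‖ ≤ δ

/-- Statement of `stub_uniformBoostedKerrDecay` (boosted Kerr–Schild `Cᵏ` decay `O(1/r)`, UNIFORM over the
label/boost window `M ∈ [m₀, m₀⁻¹]`, `|a| ≤ χM`, `‖Λ‖ ≤ L₀`). -/
def UniformBoostedKerrDecay : Prop :=
  ∀ (k : ℕ) (m₀ χ L₀ : ℝ), 0 < m₀ → ∃ C R₀ : ℝ, 0 < R₀ ∧ ∀ (M a : ℝ) (Λ : ↥lorentzGroup) (c : E4), m₀ ≤ M → M ≤ m₀⁻¹ → |a| ≤ χ * M → (∀ v : E4, ‖(Λ : E4 ≃L[ℝ] E4) v‖ ≤ L₀ * ‖v‖) → ∀ x : E4, R₀ ≤ Kerr.radius a (poincareInv Λ c x) → ∀ m ≤ k, ‖iteratedFDeriv ℝ m (fun y ↦ boostedKerrBilin Λ c M a y - Minkowski.bilin) x‖ ≤ C / Kerr.radius a (poincareInv Λ c x)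

/-- FAR-FIELD FLATNESS of a hand-over slab, uniform in the margins: at a slab point all of whose
Kerr–Schild radii are `≥ ρ ≥ ρ₀`, the `Cᵏ` jets of the deviation from `η` are `≤ ε + C/ρ` (either the
point is in the far zone, or in a near zone at large radius where `Kerrᵢ − η = O(1/rᵢ)`). -/
def FarFieldFlatness : Prop :=
  ∀ k : ℕ, ∀ (X : Type) [TopologicalSpace X] [ChartedSpace E3 X] [IsManifold (𝓡 3) (⊤ : ℕ∞) X] [T2Space X] [SecondCountableTopology X] [ConnectedSpace X] (D : InitialDataSet (𝓡 3) X) (𝒟 : VacuumCauchyDevelopment D) (N₀ : ℕ) (m₀ χ μ v₀ L₀ : ℝ), 0 < m₀ → ∃ C ρ₀ : ℝ, 0 < ρ₀ ∧ ∀ (N : ℕ) (M a r₀ : Fin N → ℝ) (mo : Fin N → ↥lorentzGroup × E4), (N ≤ N₀ ∧ (∀ i, m₀ ≤ M i ∧ M i ≤ m₀⁻¹ ∧ |a i| ≤ χ * M i ∧ Kerr.rMinus (M i) (a i) + μ ≤ r₀ i ∧ r₀ i + μ ≤ Kerr.rPlus (M i) (a i) ∧ ∀ v : E4, ‖((mo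 i).1 : E4 ≃L[ℝ] E4) v‖ ≤ L₀ * ‖v‖) ∧ (∀ i j, i ≠ j → v₀ ≤ ‖(((mo i).1 : E4 ≃L[ℝ] E4) (E4.basisVector 0) 0)⁻¹ • E4.spatial (((mo i).1 : E4 ≃L[ℝ] E4) (E4.basisVector 0)) - (((mo j).1 : E4 ≃L[ℝ] E4) (E4.basisVector 0) 0)⁻¹ • E4.spatial (((mo j).1 : E4 ≃L[ℝ] E4) (E4.basisVector 0))‖)) → ∀ (ε τ : ℝ) (R : Fin N → ℝ) (U : Opens E4) (Φ : U → 𝒟.carrier), 0 ≤ ε → ((∀ i, r₀ i + 1 ≤ R i) ∧ ContMDiff 𝓘(ℝ, E4) (𝓡 4) (⊤ : ℕ∞) Φ ∧ Topology.IsOpenEmbedding Φ ∧ {x : E4 | x 0 = τ ∧ (∀ j, r₀ j < Kerr.radius (a j) (poincareInv (mo j).1 (mo j).2 x))} ⊆ (U : Set E4) ∧ range Φ ⊆ 𝒟.metric.causalFuture 𝒟.timeOrientation (range 𝒟.embed) ∧ 𝒟.metric.IsAchronal 𝒟.timeOrientation (Φ '' {x : ↥U | (x : E4) 0 = τ}) ∧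 (∀ i, supCkENorm {x : E4 | x 0 = τ ∧ (∀ j, r₀ j < Kerr.radius (a j) (poincareInv (mo j).1 (mo j).2 x)) ∧ Kerr.radius (a i) (poincareInv (mo i).1 (mo i).2 x) ≤ R i} k (𝒟.toSpacetime.deviationExtend ⟨U, boostedKerrBilin (mo i).1 (mo i).2 (M i) (a i), fun x ↦ x 0, fun x ↦ Kerr.radius (a i) (poincareInv (mo i).1 (mo i).2 x)⟩ Φ) ≤ ENNReal.ofReal ε) ∧ supCkENorm {x : E4 | x 0 = τ ∧ (∀ j, r₀ j < Kerr.radius (a j) (poincareInv (mo j).1 (mo j).2 x)) ∧ ∀ j, R j - 1 ≤ Kerr.radius (a j) (poincareInv (mo j).1 (mo j).2 x)} k (𝒟.toSpacetime.deviationExtend (Minkowski.backgroundOn U) Φ) ≤ ENNReal.ofReal ε ∧ (∀ x : ↥U, x.1 0 = τ → (∀ j, R j - 1 ≤ Kerr.radius (a j) (poincareInv (mo j).1 (mo j).2 x.1)) → 𝒟.timeOrientation.IsFutureDirected (mfderiv 𝓘(ℝ, E4) (𝓡 4) Φ x (E4.basisVector 0)))) → ∀ z : E4, z 0 = τ → (∀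 l, r₀ l < Kerr.radius (a l) (poincareInv (mo l).1 (mo l).2 z)) → ∀ ρ : ℝ, ρ₀ ≤ ρ → (∀ l, ρ ≤ Kerr.radius (a l) (poincareInv (mo l).1 (mo l).2 z)) → ∀ m ≤ k, ‖iteratedFDeriv ℝ m (𝒟.toSpacetime.deviationExtend (Minkowski.backgroundOn U) Φ) z‖ ≤ ε + C / ρ

/-- Statement of `stub_farFieldFlatness`: far-field flatness GIVEN uniform decay. -/
def FarFieldFlatnessCond : Prop :=
  UniformBoostedKerrDecay → FarFieldFlatness

/-- Statement of `stub_flatPathExists` (from a point far from every hole, a preconnected set of far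
points — two lab segments, the second dodging the holes — reaches the hypothesis far zone; uses strict
recession, so only beyond a time `T`). -/
def FlatPathExists : Prop :=
  ∀ (N₀ : ℕ) (m₀ χ μ v₀ L₀ : ℝ), 0 < m₀ → χ < 1 → 0 < μ → 0 < v₀ → ∀ (N : ℕ) (M a r₀ : Fin N → ℝ) (mo : Fin N → ↥lorentzGroup × E4), (N ≤ N₀ ∧ (∀ i, m₀ ≤ M i ∧ M i ≤ m₀⁻¹ ∧ |a i| ≤ χ * M i ∧ Kerr.rMinus (M i) (a i) + μ ≤ r₀ i ∧ r₀ i + μ ≤ Kerr.rPlus (M i) (a i) ∧ ∀ v : E4, ‖((mo i).1 : E4 ≃L[ℝ] E4) v‖ ≤ L₀ * ‖v‖) ∧ (∀ i j, i ≠ j → v₀ ≤ ‖(((mo i).1 : E4 ≃L[ℝ] E4) (E4.basisVector 0) 0)⁻¹ • E4.spatial (((mo i).1 : E4 ≃L[ℝ] E4) (E4.basisVector 0)) - (((mo j).1 : E4 ≃L[ℝ] E4) (E4.basisVector 0) 0)⁻¹ • E4.spatial (((mo j).1 : E4 ≃L[ℝ] E4) (E4.basisVector 0))‖)) → ∀ ρ₁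 : ℝ, 0 < ρ₁ → ∃ T : ℝ, ∀ τ : ℝ, T ≤ τ → ∀ (R : Fin N → ℝ) (z : E4), z 0 = τ → (∀ i, ρ₁ ≤ Kerr.radius (a i) (poincareInv (mo i).1 (mo i).2 z)) → ∃ S : Set E4, IsPreconnected S ∧ z ∈ S ∧ (∀ x ∈ S, x 0 = τ ∧ ∀ i, ρ₁ ≤ Kerr.radius (a i) (poincareInv (mo i).1 (mo i).2 x)) ∧ ∃ z₂ ∈ S, ∀ i, R i ≤ Kerr.radius (a i) (poincareInv (mo i).1 (mo i).2 z₂)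

/-- Statement of `stub_orientationTransport` (future-directedness of `Φ_*∂₀` propagates along a
preconnected `C⁰`-flat subset of the slab from a point of the hypothesis far zone). -/
def OrientationTransport : Prop :=
  ∀ k : ℕ, ∀ (X : Type) [TopologicalSpace X] [ChartedSpace E3 X] [IsManifold (𝓡 3) (⊤ : ℕ∞) X] [T2Space X] [SecondCountableTopology X] [ConnectedSpace X] (D : InitialDataSet (𝓡 3) X) (𝒟 : VacuumCauchyDevelopment D) (N : ℕ) (M a r₀ : Fin N → ℝ) (mo : Fin N → ↥lorentzGroup × E4) (ε τ : ℝ) (R : Fin N → ℝ) (U : Opens E4) (Φ : U → 𝒟.carrier), ((∀ i, r₀ i + 1 ≤ R i) ∧ ContMDiff 𝓘(ℝ, E4) (𝓡 4) (⊤ : ℕ∞) Φ ∧ Topology.IsOpenEmbedding Φ ∧ {x : E4 | x 0 = τ ∧ (∀ j, r₀ j < Kerr.radius (a j) (poincareInv (mo j).1 (mo j).2 x))} ⊆ (U : Set E4) ∧ range Φ ⊆ 𝒟.metric.causalFuture 𝒟.timeOrientation (range 𝒟.embed) ∧ 𝒟.metric.IsAchronal 𝒟.timeOrientation (Φ ''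 {x : ↥U | (x : E4) 0 = τ}) ∧ (∀ i, supCkENorm {x : E4 | x 0 = τ ∧ (∀ j, r₀ j < Kerr.radius (a j) (poincareInv (mo j).1 (mo j).2 x)) ∧ Kerr.radius (a i) (poincareInv (mo i).1 (mo i).2 x) ≤ R i} k (𝒟.toSpacetime.deviationExtend ⟨U, boostedKerrBilin (mo i).1 (mo i).2 (M i) (a i), fun x ↦ x 0, fun x ↦ Kerr.radius (a i) (poincareInv (mo i).1 (mo i).2 x)⟩ Φ) ≤ ENNReal.ofReal ε) ∧ supCkENorm {x : E4 | x 0 = τ ∧ (∀ j, r₀ j < Kerr.radius (a j) (poincareInv (mo j).1 (mo j).2 x)) ∧ ∀ j, R j - 1 ≤ Kerr.radius (a j) (poincareInv (mo j).1 (mo j).2 x)} k (𝒟.toSpacetime.deviationExtend (Minkowski.backgroundOn U) Φ) ≤ ENNReal.ofReal ε ∧ (∀ x : ↥U, x.1 0 = τ → (∀ j, R j - 1 ≤ Kerr.radius (a j) (poincareInv (mo j).1 (mo j).2 x.1)) → 𝒟.timeOrientation.IsFutureDirected (mfderiv 𝓘(ℝ, E4) (𝓡 4) Φ x (E4.basisVector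 0)))) → ∀ S : Set E4, IsPreconnected S → S ⊆ {x : E4 | x 0 = τ ∧ ∀ j, r₀ j < Kerr.radius (a j) (poincareInv (mo j).1 (mo j).2 x)} → (∀ x ∈ S, ‖𝒟.toSpacetime.deviationExtend (Minkowski.backgroundOn U) Φ x‖ < 1) → (∃ z₂ ∈ S, ∀ j, R j - 1 ≤ Kerr.radius (a j) (poincareInv (mo j).1 (mo j).2 z₂)) → ∀ x : ↥U, x.1 ∈ S → 𝒟.timeOrientation.IsFutureDirected (mfderiv 𝓘(ℝ, E4) (𝓡 4) Φ x (E4.basisVector 0))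

/-- Statement of `stub_reanchorMapExists` (the GLOBAL re-anchoring diffeomorphism: per-hole affine
Poincaré re-gaugings glued to the identity by spatial bumps; static, pure `E4` geometry). -/
def ReanchorMapExists : Prop :=
  ∀ (k N : ℕ) (L₀ η : ℝ), 1 ≤ L₀ → 0 < η → ∃ δ : ℝ, 0 < δ ∧ ∀ (Λn Λl : Fin N → ↥lorentzGroup) (cn cl : Fin N → E4) (τ ϱ : ℝ), 1 ≤ ϱ → (∀ j, ‖(((Λl j : ↥lorentzGroup) : E4 ≃L[ℝ] E4) : E4 →L[ℝ] E4)‖ ≤ L₀ ∧ ‖((((Λl j : ↥lorentzGroup) : E4 ≃L[ℝ] E4)).symm : E4 →L[ℝ] E4)‖ ≤ L₀ ∧ ‖(((Λn j : ↥lorentzGroup) : E4 ≃L[ℝ] E4) : E4 →L[ℝ] E4)‖ ≤ L₀ ∧ ‖(((Λn j : ↥lorentzGroup) : E4 ≃L[ℝ] E4) : E4 →L[ℝ] E4) - (((Λl j : ↥lorentzGroup) : E4 ≃L[ℝ] E4) : E4 →L[ℝ] E4)‖ ≤ δ) → (∀ j, ‖(E4.spatial (cn j) + ((τ) - (cn j)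 0) • (((((Λn j : ↥lorentzGroup) : E4 ≃L[ℝ] E4)) (E4.basisVector 0) 0)⁻¹ • E4.spatial ((((Λn j : ↥lorentzGroup) : E4 ≃L[ℝ] E4)) (E4.basisVector 0)))) - (E4.spatial (cl j) + ((τ) - (cl j) 0) • (((((Λl j : ↥lorentzGroup) : E4 ≃L[ℝ] E4)) (E4.basisVector 0) 0)⁻¹ • E4.spatial ((((Λl j : ↥lorentzGroup) : E4 ≃L[ℝ] E4)) (E4.basisVector 0))))‖ ≤ δ * ϱ) → (∀ i j, i ≠ j → 16 * ϱ ≤ ‖(E4.spatial (cl i) + ((τ) - (cl i) 0) • (((((Λl i : ↥lorentzGroup) : E4 ≃L[ℝ] E4)) (E4.basisVector 0) 0)⁻¹ • E4.spatial ((((Λl i : ↥lorentzGroup) : E4 ≃L[ℝ] E4)) (E4.basisVector 0)))) - (E4.spatial (cl j) + ((τ) - (cl j) 0) • (((((Λl j : ↥lorentzGroup) : E4 ≃L[ℝ] E4)) (E4.basisVector 0) 0)⁻¹ • E4.spatial ((((Λl j : ↥lorentzGroup) : E4 ≃L[ℝ] E4)) (E4.basisVector 0))))‖) → ∃ (Θ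 : E4 → E4) (T : Fin N → E4 →L[ℝ] E4) (β : Fin N → ℝ), ContDiff ℝ (⊤ : ℕ∞) Θ ∧ (∀ x, (Θ x) 0 = x 0) ∧ (∀ x : E4, |x 0 - τ| < 1 → ‖fderiv ℝ Θ x - ContinuousLinearMap.id ℝ E4‖ ≤ η ∧ ‖Θ x - x‖ ≤ η * ϱ ∧ ∀ m : ℕ, 2 ≤ m → m ≤ k + 1 → ‖iteratedFDeriv ℝ m Θ x‖ ≤ η) ∧ Topology.IsOpenEmbedding ({x : E4 | |x 0 - τ| < 1}.restrict Θ) ∧ (∀ j, ‖T j - ((((Λl j : ↥lorentzGroup) : E4 ≃L[ℝ] E4)).symm : E4 →L[ℝ] E4)‖ ≤ η ∧ (∃ κ : ℝ, T j (((Λl j : ↥lorentzGroup) : E4 ≃L[ℝ] E4) (E4.basisVector 0)) = κ • E4.basisVector 0) ∧ ∀ x : E4, |x 0 - τ| < 1 → ‖E4.spatial x - (E4.spatial (cl j) + ((τ) - (cl j) 0) • (((((Λl j : ↥lorentzGroup) : E4 ≃L[ℝ] E4)) (E4.basisVector 0) 0)⁻¹ • E4.spatial ((((Λl j : ↥lorentzGroup)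 : E4 ≃L[ℝ] E4)) (E4.basisVector 0))))‖ ≤ ϱ → fderiv ℝ Θ x = (((Λn j : ↥lorentzGroup) : E4 ≃L[ℝ] E4) : E4 →L[ℝ] E4).comp (T j) ∧ poincareInv (Λn j) (cn j) (Θ x) = T j (x - cl j) + β j • E4.basisVector 0)

/-- Statement of `stub_slabTransferCore2`: the slab transfer GIVEN all the pieces. -/
def SlabTransferCore2 : Prop :=
  UniformBoostedKerrDecay → FarFieldFlatnessCond → FlatPathExists → OrientationTransport →
    ReanchorMapExists → LargeNearZones → DirectionDodging → KerrFamilyContinuity → SlabTransfer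

/-- Statement of `stub_reanchorMapShear`: the global re-anchoring map with the EXPLICIT per-hole frame map
`Tⱼ = (I + e₀ ⊗ κ⁻¹(λₗⱼ − λₙⱼ)) ∘ Λₗⱼ⁻¹` (the canonical time shear; needed so that `Tⱼ v` and `Λₗⱼ⁻¹ v` have the same spatial
part, which makes the Kerr–Schild radii of `Θ x` about the `n`-th hole EQUAL those of `x` about the limit hole, and so that `Tⱼ`
depends on `n` only, as `stub_kerrFamilyContinuity` wants). -/
def ReanchorMapShear : Prop :=
  ∀ (k N : ℕ) (L₀ η : ℝ), 1 ≤ L₀ → 0 < η → ∃ δ : ℝ, 0 < δ ∧ ∀ (Λn Λl : Fin N → ↥lorentzGroup) (cn cl : Fin N → E4) (τ ϱ : ℝ), 1 ≤ ϱ → (∀ j, ‖(((Λl j : ↥lorentzGroup) : E4 ≃L[ℝ] E4) : E4 →L[ℝ] E4)‖ ≤ L₀ ∧ ‖((((Λl j : ↥lorentzGroup) : E4 ≃L[ℝ] E4)).symm : E4 →L[ℝ] E4)‖ ≤ L₀ ∧ ‖(((Λn j : ↥lorentzGroup) : E4 ≃L[ℝ] E4) : E4 →L[ℝ] E4)‖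 ≤ L₀ ∧ ‖(((Λn j : ↥lorentzGroup) : E4 ≃L[ℝ] E4) : E4 →L[ℝ] E4) - (((Λl j : ↥lorentzGroup) : E4 ≃L[ℝ] E4) : E4 →L[ℝ] E4)‖ ≤ δ) → (∀ j, ‖(E4.spatial (cn j) + ((τ) - (cn j) 0) • (((((Λn j : ↥lorentzGroup) : E4 ≃L[ℝ] E4)) (E4.basisVector 0) 0)⁻¹ • E4.spatial ((((Λn j : ↥lorentzGroup) : E4 ≃L[ℝ] E4)) (E4.basisVector 0)))) - (E4.spatial (cl j) + ((τ) - (cl j) 0) • (((((Λl j : ↥lorentzGroup) : E4 ≃L[ℝ] E4)) (E4.basisVector 0) 0)⁻¹ • E4.spatial ((((Λl j : ↥lorentzGroup) : E4 ≃L[ℝ] E4)) (E4.basisVector 0))))‖ ≤ δ * ϱ) → (∀ i j, i ≠ j → 16 * ϱ ≤ ‖(E4.spatial (cl i) + ((τ) - (cl i) 0) • (((((Λl i : ↥lorentzGroup) : E4 ≃L[ℝ] E4)) (E4.basisVector 0) 0)⁻¹ • E4.spatial ((((Λl i : ↥lorentzGroup) : E4 ≃L[ℝ] E4)) (E4.basisVector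 0)))) - (E4.spatial (cl j) + ((τ) - (cl j) 0) • (((((Λl j : ↥lorentzGroup) : E4 ≃L[ℝ] E4)) (E4.basisVector 0) 0)⁻¹ • E4.spatial ((((Λl j : ↥lorentzGroup) : E4 ≃L[ℝ] E4)) (E4.basisVector 0))))‖) → ∃ (Θ : E4 → E4) (β : Fin N → ℝ), ContDiff ℝ (⊤ : ℕ∞) Θ ∧ (∀ x, (Θ x) 0 = x 0) ∧ (∀ x : E4, |x 0 - τ| < 1 → ‖fderiv ℝ Θ x - ContinuousLinearMap.id ℝ E4‖ ≤ η ∧ ‖Θ x - x‖ ≤ η * ϱ ∧ ∀ m : ℕ, 2 ≤ m → m ≤ k + 1 → ‖iteratedFDeriv ℝ m Θ x‖ ≤ η) ∧ Topology.IsOpenEmbedding ({x : E4 | |x 0 - τ| < 1}.restrict Θ) ∧ (∀ j, ∀ x : E4, |x 0 - τ| < 1 → ‖E4.spatial x - (E4.spatial (cl j) + ((τ) - (cl j) 0) • (((((Λl j : ↥lorentzGroup) : E4 ≃L[ℝ] E4)) (E4.basisVector 0) 0)⁻¹ • E4.spatial ((((Λl j : ↥lorentzGroup) : E4 ≃L[ℝ]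 E4)) (E4.basisVector 0))))‖ ≤ ϱ → fderiv ℝ Θ x = (((Λn j : ↥lorentzGroup) : E4 ≃L[ℝ] E4) : E4 →L[ℝ] E4).comp ((ContinuousLinearMap.id ℝ E4 + (((((Λn j : ↥lorentzGroup) : E4 ≃L[ℝ] E4) (E4.basisVector 0)) 0)⁻¹ • ((E4.dx 0).comp (((Λl j : ↥lorentzGroup) : E4 ≃L[ℝ] E4) : E4 →L[ℝ] E4) - (E4.dx 0).comp (((Λn j : ↥lorentzGroup) : E4 ≃L[ℝ] E4) : E4 →L[ℝ] E4))).smulRight (E4.basisVector 0)).comp ((((Λl j : ↥lorentzGroup) : E4 ≃L[ℝ] E4)).symm : E4 →L[ℝ] E4)) ∧ poincareInv (Λn j) (cn j) (Θ x) = ((ContinuousLinearMap.id ℝ E4 + (((((Λn j : ↥lorentzGroup) : E4 ≃L[ℝ] E4) (E4.basisVector 0)) 0)⁻¹ • ((E4.dx 0).comp (((Λl j : ↥lorentzGroup) : E4 ≃L[ℝ] E4) : E4 →L[ℝ] E4) - (E4.dx 0).comp (((Λn j : ↥lorentzGroup) : E4 ≃L[ℝ] E4) : E4 →L[ℝ]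 E4))).smulRight (E4.basisVector 0)).comp ((((Λl j : ↥lorentzGroup) : E4 ≃L[ℝ] E4)).symm : E4 →L[ℝ] E4)) (x - cl j) + β j • E4.basisVector 0)

/-- Statement of `stub_transferChart`: the precomposed chart `Φ ∘ θ` on `U' = {|x⁰−τ|<1} ∩ Θ⁻¹U ∩ {rₗ > r₀ₗ}` — smooth open
embedding, covering the limit slab, image in `J⁺(ιΣ)`, achronal slab image, chain rule, and the deviation identity
`dev'_{B'} = Θ^*(dev_B + B) − B'` near every point of `U'` (for arbitrary reference forms `B`, `B'`). -/
def TransferChart : Prop :=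
  ∀ k : ℕ, ∀ (X : Type) [TopologicalSpace X] [ChartedSpace E3 X] [IsManifold (𝓡 3) (⊤ : ℕ∞) X] [T2Space X] [SecondCountableTopology X] [ConnectedSpace X] (D : InitialDataSet (𝓡 3) X) (𝒟 : VacuumCauchyDevelopment D) (N : ℕ) (aₙ r₀ₙ : Fin N → ℝ) (moₙ : Fin N → ↥lorentzGroup × E4) (aₗ r₀ₗ : Fin N → ℝ) (moₗ : Fin N → ↥lorentzGroup × E4) (τ : ℝ) (U : Opens E4) (Φ : U → 𝒟.carrier) (Θ : E4 → E4), ContMDiff 𝓘(ℝ, E4) (𝓡 4) (⊤ : ℕ∞) Φ → Topology.IsOpenEmbedding Φ → {x : E4 | x 0 = τ ∧ ∀ j, r₀ₙ j < Kerr.radius (aₙ j) (poincareInv (moₙ j).1 (moₙ j).2 x)} ⊆ (U : Set E4) → range Φ ⊆ 𝒟.metric.causalFuture 𝒟.timeOrientation (range 𝒟.embed) → 𝒟.metric.IsAchronal 𝒟.timeOrientation (Φ '' {x : ↥U | (x : E4) 0 = τ}) → ContDiff ℝ (⊤ : ℕ∞) Θ → (∀ x, (Θ x) 0 = x 0) →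 Topology.IsOpenEmbedding ({x : E4 | |x 0 - τ| < 1}.restrict Θ) → (∀ x : E4, x 0 = τ → (∀ j, r₀ₗ j < Kerr.radius (aₗ j) (poincareInv (moₗ j).1 (moₗ j).2 x)) → ∀ j, r₀ₙ j < Kerr.radius (aₙ j) (poincareInv (moₙ j).1 (moₙ j).2 (Θ x))) → ∃ (U' : Opens E4) (θ : U' → U), (U' : Set E4) = {x : E4 | |x 0 - τ| < 1} ∩ Θ ⁻¹' (U : Set E4) ∩ {x : E4 | ∀ j, r₀ₗ j < Kerr.radius (aₗ j) (poincareInv (moₗ j).1 (moₗ j).2 x)} ∧ (∀ x : U', ((θ x : U) : E4) = Θ x) ∧ ContMDiff 𝓘(ℝ, E4) (𝓡 4) (⊤ : ℕ∞) (Φ ∘ θ) ∧ Topology.IsOpenEmbedding (Φ ∘ θ) ∧ {x : E4 | x 0 = τ ∧ ∀ j, r₀ₗ j < Kerr.radius (aₗ j) (poincareInv (moₗ j).1 (moₗ j).2 x)} ⊆ (U' : Set E4) ∧ range (Φ ∘ θ) ⊆ 𝒟.metric.causalFuture 𝒟.timeOrientation (range 𝒟.embed) ∧ 𝒟.metric.IsAchronal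 𝒟.timeOrientation ((Φ ∘ θ) '' {x : ↥U' | (x : E4) 0 = τ}) ∧ (∀ x : U', ∀ v : E4, mfderiv 𝓘(ℝ, E4) (𝓡 4) (Φ ∘ θ) x v = mfderiv 𝓘(ℝ, E4) (𝓡 4) Φ (θ x) (fderiv ℝ Θ x v)) ∧ (∀ (Bg Bg' : E4 → E4 →L[ℝ] E4 →L[ℝ] ℝ) (tm tm' rd rd' : E4 → ℝ) (x : U'), 𝒟.toSpacetime.deviationExtend ⟨U', Bg', tm', rd'⟩ (Φ ∘ θ) =ᶠ[𝓝 (x : E4)] fun y ↦ bilinPullback Θ (fun z ↦ 𝒟.toSpacetime.deviationExtend ⟨U, Bg, tm, rd⟩ Φ z + Bg z) y - Bg' y)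

/-- Statement of `stub_slabTransferCore3`: the slab transfer GIVEN A', P-struct and all earlier pieces. -/
def SlabTransferCore3 : Prop :=
  ReanchorMapShear → TransferChart → SlabTransferCore2

/-- Statement of `stub_slabTransferAtTime` (the transfer for two FIXED configurations at a fixed lab time, every
smallness/largeness fact an explicit hypothesis; stated by the assembly worker, registered verbatim by the lead). -/
def SlabTransferAtTime : Prop :=
  ∀ k : ℕ, ∀ (X : Type) [TopologicalSpace X] [ChartedSpace E3 X] [IsManifold (𝓡 3) (⊤ : ℕ∞) X] [T2Space X] [SecondCountableTopology X] [ConnectedSpace X] (D : InitialDataSet (𝓡 3) X) (𝒟 : VacuumCauchyDevelopment D) (N : ℕ) (μ A : ℝ) (Mₙ aₙ r₀ₙ : Fin N → ℝ) (moₙ : Fin N → ↥lorentzGroup × E4) (Mₗ aₗ r₀ₗ : Fin N → ℝ) (moₗ : Fin N → ↥lorentzGroup × E4) (τ ε ε' Rb ϱ η δc f₀ : ℝ) (Θ : E4 → E4) (β : Fin N → ℝ) (T : Fin N → E4 →L[ℝ] E4) (φ : Fin N → E4 →L[ℝ] ℝ) (Xₙ Xₗ : Fin N → E3) (R : Fin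 N → ℝ) (U : Opens E4) (Φ : U → 𝒟.carrier), 0 < μ → 0 ≤ A → 2 ≤ Rb → (∀ i, μ ≤ r₀ₙ i ∧ r₀ₙ i + μ / 4 ≤ r₀ₗ i ∧ r₀ₙ i + 2 ≤ Rb ∧ r₀ₗ i + 2 ≤ Rb ∧ |aₙ i| ≤ A ∧ |aₗ i| ≤ A) → (∀ i (y : E4), μ ≤ Kerr.radius (aₗ i) y → |Kerr.radius (aₙ i) y - Kerr.radius (aₗ i) y| ≤ min (μ / 8) 1) → 2 * (Rb + A + 3) ≤ ϱ → 0 < ε → 0 ≤ η → η ≤ 1 / 8 → 0 ≤ f₀ → f₀ ≤ 1 / 8 → 4 ^ k * (k.factorial : ℝ) * 2 ^ (k + 2) * ε + δc ≤ ε' → 4 ^ k * (k.factorial : ℝ) * 2 ^ (k + 2) * f₀ + 2 ^ (k + 2) * ‖Minkowski.bilin‖ * η ≤ ε' → (∀ j, Xₙ j = E4.spatial (moₙ j).2 + (τ - (moₙ j).2 0) • ((((moₙ j).1 : E4 ≃L[ℝ] E4) (E4.basisVector 0) 0)⁻¹ • E4.spatial (((moₙ j).1 : E4 ≃L[ℝ]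 E4) (E4.basisVector 0)))) → (∀ j, Xₗ j = E4.spatial (moₗ j).2 + (τ - (moₗ j).2 0) • ((((moₗ j).1 : E4 ≃L[ℝ] E4) (E4.basisVector 0) 0)⁻¹ • E4.spatial (((moₗ j).1 : E4 ≃L[ℝ] E4) (E4.basisVector 0)))) → (∀ j, ‖Xₙ j - Xₗ j‖ ≤ ϱ / 8) → (∀ j, T j = (ContinuousLinearMap.id ℝ E4 + (φ j).smulRight (E4.basisVector 0)).comp ((((moₗ j).1 : E4 ≃L[ℝ] E4).symm : E4 →L[ℝ] E4))) → ContDiff ℝ (⊤ : ℕ∞) Θ → (∀ x, (Θ x) 0 = x 0) → (∀ x : E4, |x 0 - τ| < 1 → ‖fderiv ℝ Θ x - ContinuousLinearMap.id ℝ E4‖ ≤ η ∧ ‖Θ x - x‖ ≤ η * ϱ ∧ ∀ m : ℕ, 2 ≤ m → m ≤ k + 1 → ‖iteratedFDeriv ℝ m Θ x‖ ≤ η) → Topology.IsOpenEmbedding ({x : E4 | |x 0 - τ| < 1}.restrict Θ) → (∀ j, ∀ x : E4, |x 0 - τ| < 1 → ‖E4.spatial x - Xₗ j‖ ≤ ϱ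 → fderiv ℝ Θ x = (((moₙ j).1 : E4 ≃L[ℝ] E4) : E4 →L[ℝ] E4).comp (T j) ∧ poincareInv (moₙ j).1 (moₙ j).2 (Θ x) = T j (x - (moₗ j).2) + β j • E4.basisVector 0) → (∀ j, ∀ i ≤ k, ∀ x : E4, μ ≤ Kerr.radius (aₗ j) (poincareInv (moₗ j).1 (moₗ j).2 x) → Kerr.radius (aₗ j) (poincareInv (moₗ j).1 (moₗ j).2 x) ≤ Rb + 1 → ‖iteratedFDeriv ℝ i (fun z ↦ (ContinuousLinearMap.precomp ℝ (T j)).comp ((Kerr.bilin (Mₙ j) (aₙ j) (T j (z - (moₗ j).2))).comp (T j))) x - iteratedFDeriv ℝ i (boostedKerrBilin (moₗ j).1 (moₗ j).2 (Mₗ j) (aₗ j)) x‖ ≤ δc) → SlabWith k 𝒟 N Mₙ aₙ r₀ₙ moₙ ε τ R U Φ → (∀ j, Rb + 3 ≤ R j) → (∀ z : E4, z 0 = τ → (∀ l, r₀ₙ l < Kerr.radius (aₙ l) (poincareInv (moₙ l).1 (moₙ l).2 z)) → (∀ l, Rb - 1 ≤ Kerr.radius (aₙ l) (poincareInv (moₙ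 l).1 (moₙ l).2 z)) → ∀ m ≤ k, ‖iteratedFDeriv ℝ m (𝒟.toSpacetime.deviationExtend (Minkowski.backgroundOn U) Φ) z‖ ≤ f₀) → (∀ z : E4, z 0 = τ → (∀ i, Rb - 1 ≤ Kerr.radius (aₙ i) (poincareInv (moₙ i).1 (moₙ i).2 z)) → ∃ S : Set E4, IsPreconnected S ∧ z ∈ S ∧ (∀ x ∈ S, x 0 = τ ∧ ∀ i, Rb - 1 ≤ Kerr.radius (aₙ i) (poincareInv (moₙ i).1 (moₙ i).2 x)) ∧ ∃ z₂ ∈ S, ∀ i, R i ≤ Kerr.radius (aₙ i) (poincareInv (moₙ i).1 (moₙ i).2 z₂)) → SlabAt k 𝒟 N Mₗ aₗ r₀ₗ moₗ ε' τ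

/-- Statement of `stub_chargeStabilisation` (CHARGE STABILISATION, pointwise). -/
def ChargeStabilisation : Prop :=
  ∀ k : ℕ, ∀ (X : Type) [TopologicalSpace X] [ChartedSpace E3 X] [IsManifold (𝓡 3) (⊤ : ℕ∞) X] [T2Space X] [SecondCountableTopology X] [ConnectedSpace X] (D : InitialDataSet (𝓡 3) X) (𝒟 : VacuumCauchyDevelopment D), FloatingRecurrence k 𝒟 → FixedRecurrence k 𝒟

namespace Goal
/-- Statement of `stub_weakCosmicCensorshipTame` (rev 12), under the stub's name. -/
abbrev stub_weakCosmicCensorshipTame : Prop := WeakCosmicCensorshipTame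
/-- Statement of `stub_recurrenceAlongCensoredCurves` (rev 13), under the stub's name. -/
abbrev stub_recurrenceAlongCensoredCurves : Prop := RecurrenceAlongCensoredCurves
/-- Statement of `stub_interiorLemmaAlongRecurrentCurves` (rev 13), under the stub's name. -/
abbrev stub_interiorLemmaAlongRecurrentCurves : Prop := InteriorLemmaAlongRecurrentCurves
/-- Statement of `stub_marginCompactness`, under the stub's name. -/
abbrev stub_marginCompactness : Prop := MarginCompactness
/-- Statement of `stub_largeNearZones`, under the stub's name. -/
abbrev stub_largeNearZones : Prop := LargeNearZones
/-- Statement of `stub_directionDodging`, under the stub's name. -/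
abbrev stub_directionDodging : Prop := DirectionDodging
/-- Statement of `stub_kerrFamilyContinuity`, under the stub's name. -/
abbrev stub_kerrFamilyContinuity : Prop := KerrFamilyContinuity
/-- Statement of `stub_uniformBoostedKerrDecay`, under the stub's name. -/
abbrev stub_uniformBoostedKerrDecay : Prop := UniformBoostedKerrDecay
/-- Statement of `stub_farFieldFlatness`, under the stub's name. -/
abbrev stub_farFieldFlatness : Prop := FarFieldFlatnessCond
/-- Statement of `stub_flatPathExists`, under the stub's name. -/
abbrev stub_flatPathExists : Prop := FlatPathExists
/-- Statement of `stub_orientationTransport`, under the stub's name. -/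
abbrev stub_orientationTransport : Prop := OrientationTransport
/-- Statement of `stub_reanchorMapExists`, under the stub's name. -/
abbrev stub_reanchorMapExists : Prop := ReanchorMapExists
/-- Statement of `stub_reanchorMapShear`, under the stub's name. -/
abbrev stub_reanchorMapShear : Prop := ReanchorMapShear
/-- Statement of `stub_transferChart`, under the stub's name. -/
abbrev stub_transferChart : Prop := TransferChart
/-- Statement of `stub_slabTransferCore3`, under the stub's name. -/
abbrev stub_slabTransferCore3 : Prop := SlabTransferCore3
/-- Statement of `stub_slabTransferAtTime`, under the stub's name. -/
abbrev stub_slabTransferAtTime : Prop := SlabTransferAtTime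
/-- Statement of `stub_slabAtMono`, under the stub's name. -/
abbrev stub_slabAtMono : Prop := ∀ k : ℕ, ∀ (X : Type) [TopologicalSpace X] [ChartedSpace E3 X] [IsManifold (𝓡 3) (⊤ : ℕ∞) X] [T2Space X] [SecondCountableTopology X] [ConnectedSpace X] (D : InitialDataSet (𝓡 3) X) (𝒟 : VacuumCauchyDevelopment D) (N : ℕ) (M a r₀ : Fin N → ℝ) (mo : Fin N → ↥lorentzGroup × E4) (ε ε' τ : ℝ), ε ≤ ε' → (∃ (R : Fin N → ℝ) (U : Opens E4) (Φ : U → 𝒟.carrier), (∀ i, r₀ i + 1 ≤ R i) ∧ ContMDiff 𝓘(ℝ, E4) (𝓡 4) (⊤ : ℕ∞) Φ ∧ Topology.IsOpenEmbedding Φ ∧ {x : E4 | x 0 = τ ∧ (∀ j, r₀ j < Kerr.radius (a j) (poincareInv (mo j).1 (mo j).2 x))} ⊆ (U : Set E4) ∧ range Φ ⊆ 𝒟.metric.causalFuture 𝒟.timeOrientation (range 𝒟.embed) ∧ 𝒟.metric.IsAchronal 𝒟.timeOrientation (Φ '' {x : ↥U | (x : E4) 0 = τ}) ∧ (∀ i,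 supCkENorm {x : E4 | x 0 = τ ∧ (∀ j, r₀ j < Kerr.radius (a j) (poincareInv (mo j).1 (mo j).2 x)) ∧ Kerr.radius (a i) (poincareInv (mo i).1 (mo i).2 x) ≤ R i} k (𝒟.toSpacetime.deviationExtend ⟨U, boostedKerrBilin (mo i).1 (mo i).2 (M i) (a i), fun x ↦ x 0, fun x ↦ Kerr.radius (a i) (poincareInv (mo i).1 (mo i).2 x)⟩ Φ) ≤ ENNReal.ofReal ε) ∧ supCkENorm {x : E4 | x 0 = τ ∧ (∀ j, r₀ j < Kerr.radius (a j) (poincareInv (mo j).1 (mo j).2 x)) ∧ ∀ j, R j - 1 ≤ Kerr.radius (a j) (poincareInv (mo j).1 (mo j).2 x)} k (𝒟.toSpacetime.deviationExtend (Minkowski.backgroundOn U) Φ) ≤ ENNReal.ofReal ε ∧ (∀ x : ↥U, x.1 0 = τ → (∀ j, R j - 1 ≤ Kerr.radius (a j) (poincareInv (mo j).1 (mo j).2 x.1)) → 𝒟.timeOrientation.IsFutureDirected (mfderiv 𝓘(ℝ, E4) (𝓡 4) Φ x (E4.basisVector 0)))) → ∃ (R : Fin N → ℝ) (U : Opens E4)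 (Φ : U → 𝒟.carrier), (∀ i, r₀ i + 1 ≤ R i) ∧ ContMDiff 𝓘(ℝ, E4) (𝓡 4) (⊤ : ℕ∞) Φ ∧ Topology.IsOpenEmbedding Φ ∧ {x : E4 | x 0 = τ ∧ (∀ j, r₀ j < Kerr.radius (a j) (poincareInv (mo j).1 (mo j).2 x))} ⊆ (U : Set E4) ∧ range Φ ⊆ 𝒟.metric.causalFuture 𝒟.timeOrientation (range 𝒟.embed) ∧ 𝒟.metric.IsAchronal 𝒟.timeOrientation (Φ '' {x : ↥U | (x : E4) 0 = τ}) ∧ (∀ i, supCkENorm {x : E4 | x 0 = τ ∧ (∀ j, r₀ j < Kerr.radius (a j) (poincareInv (mo j).1 (mo j).2 x)) ∧ Kerr.radius (a i) (poincareInv (mo i).1 (mo i).2 x) ≤ R i} k (𝒟.toSpacetime.deviationExtend ⟨U, boostedKerrBilin (mo i).1 (mo i).2 (M i) (a i), fun x ↦ x 0, fun x ↦ Kerr.radius (a i) (poincareInv (mo i).1 (mo i).2 x)⟩ Φ) ≤ ENNReal.ofReal ε') ∧ supCkENorm {x : E4 | x 0 = τ ∧ (∀ j, r₀ j < Kerr.radius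 (a j) (poincareInv (mo j).1 (mo j).2 x)) ∧ ∀ j, R j - 1 ≤ Kerr.radius (a j) (poincareInv (mo j).1 (mo j).2 x)} k (𝒟.toSpacetime.deviationExtend (Minkowski.backgroundOn U) Φ) ≤ ENNReal.ofReal ε' ∧ (∀ x : ↥U, x.1 0 = τ → (∀ j, R j - 1 ≤ Kerr.radius (a j) (poincareInv (mo j).1 (mo j).2 x.1)) → 𝒟.timeOrientation.IsFutureDirected (mfderiv 𝓘(ℝ, E4) (𝓡 4) Φ x (E4.basisVector 0)))
/-- Statement of `stub_slabTransferFinal`, under the stub's name (`= SlabTransfer`). -/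
abbrev stub_slabTransferFinal : Prop := SlabTransfer
end Goal

/-! ## Registered stubs (the only `sorry`s of the file), stated expanded over tree declarations. -/

/-- stub 1 (rev 12) — TAME WEAK COSMIC CENSORSHIP: for every data manifold `X`, tame-Christodoulou-generically
in `admissibleVacuumData X`, a maximal vacuum Cauchy development exists and every maximal vacuum Cauchy
development has complete future null infinity (sojourn form). VERBATIM the body of the registered open item
`Summit.FinalStateConjecture.FinalStateConjecture.Theses.PhaseMixingCapture.WeakCosmicCensorshipTame`
(stmt-FinalStateConjecture-17269) — the summit's shared open leaf (Christodoulou, CQG 16 (1999) A23, p. A24);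
open problem, NOT a worker's task. -/
theorem stub_weakCosmicCensorshipTame : ∀ (X : Type) [TopologicalSpace X] [ChartedSpace E3 X] [IsManifold (𝓡 3) (⊤ : ℕ∞) X] [T2Space X] [SecondCountableTopology X] [ConnectedSpace X], InitialDataSet.IsTameChristodoulouGeneric (admissibleVacuumData X) (fun D ↦ (∃ 𝒟 : VacuumCauchyDevelopment D, 𝒟.IsMaximal) ∧ ∀ 𝒟 : VacuumCauchyDevelopment D, 𝒟.IsMaximal → Summit.FinalStateConjecture.HasCompleteNullInfinity 𝒟.toCauchyDevelopment) 1 := by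
  sorry

/-- stub 2a (rev 13) — RECURRENCE ALONG CENSORED CURVES (the route's dynamical content of CAPTURE, relative to weak
cosmic censorship): for every `k`, `X`, every end `e` and every tame curve `F` of admissible data on `e` — immersed at `0`
and injective, or constant — whose members off `0` are CENSORED (an MGHD exists, every MGHD has complete `𝓘⁺`) and whose
base datum `F 0` is EXCEPTIONAL for `P₁ k` = "every MGHD has complete `𝓘⁺` and recurs with floating charges in one margin
family `(N₀, m₀, χ < 1, μ, v₀, L₀)` in the one-chart `Cᵏ` slab sense", there pass an end `e'` and a tame, injective,
immersed curve `F'` of admissible data through `F 0` whose members off `0` satisfy `P₁ k`. Given stub 1 this is EQUIVALENT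
to tame genericity of `P₁ k` (`InitialDataSet.isTameChristodoulouGeneric_iff_relative_exceptional`): "the ω-limit states of
censored generic developments are non-degenerate, strictly receding, sub-extremal multi-Kerr configurations" — the
large-data final-state problem given censorship, in recurrence form; open problem. -/
theorem stub_recurrenceAlongCensoredCurves : ∀ k : ℕ, ∀ (X : Type) [TopologicalSpace X] [ChartedSpace E3 X] [IsManifold (𝓡 3) (⊤ : ℕ∞) X] [T2Space X] [SecondCountableTopology X] [ConnectedSpace X] (e : AFEnd X) (F : EuclideanSpace ℝ (Fin 1) → InitialDataSet (𝓡 3) X), InitialDataSet.IsTameDataFamily e 1 F → ((InitialDataSet.IsImmersedAtZero 1 F ∧ Injective F) ∨ ∀ c, F c = F 0) → (∀ c, F c ∈ admissibleVacuumData X) → (∀ c ≠ 0, ((∃ 𝒟 : VacuumCauchyDevelopment (F c), 𝒟.IsMaximal) ∧ ∀ 𝒟 : VacuumCauchyDevelopment (F c), 𝒟.IsMaximal → Summit.FinalStateConjecture.HasCompleteNullInfinity 𝒟.toCauchyDevelopment)) → ¬ (∀ 𝒟 : VacuumCauchyDevelopment (F 0), 𝒟.IsMaximal → Summit.FinalStateConjecture.HasCompleteNullInfinity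 𝒟.toCauchyDevelopment ∧ (∃ (N₀ : ℕ) (m₀ χ μ v₀ L₀ : ℝ), 0 < m₀ ∧ χ < 1 ∧ 0 < μ ∧ 0 < v₀ ∧ ∀ ε : ℝ, 0 < ε → ∃ (N : ℕ) (M a r₀ : Fin N → ℝ) (mo : Fin N → ↥lorentzGroup × E4), (N ≤ N₀ ∧ (∀ i, m₀ ≤ M i ∧ M i ≤ m₀⁻¹ ∧ |a i| ≤ χ * M i ∧ Kerr.rMinus (M i) (a i) + μ ≤ r₀ i ∧ r₀ i + μ ≤ Kerr.rPlus (M i) (a i) ∧ ∀ v : E4, ‖((mo i).1 : E4 ≃L[ℝ] E4) v‖ ≤ L₀ * ‖v‖) ∧ (∀ i j, i ≠ j → v₀ ≤ ‖(((mo i).1 : E4 ≃L[ℝ] E4) (E4.basisVector 0) 0)⁻¹ • E4.spatial (((mo i).1 : E4 ≃L[ℝ] E4) (E4.basisVector 0)) - (((mo j).1 : E4 ≃L[ℝ] E4) (E4.basisVector 0) 0)⁻¹ • E4.spatial (((mo j).1 : E4 ≃L[ℝ] E4) (E4.basisVector 0))‖)) ∧ ∀ τ₁ : ℝ, ∃ τ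 : ℝ, τ₁ ≤ τ ∧ ∃ (R : Fin N → ℝ) (U : Opens E4) (Φ : U → 𝒟.carrier), (∀ i, r₀ i + 1 ≤ R i) ∧ ContMDiff 𝓘(ℝ, E4) (𝓡 4) (⊤ : ℕ∞) Φ ∧ Topology.IsOpenEmbedding Φ ∧ {x : E4 | x 0 = τ ∧ (∀ j, r₀ j < Kerr.radius (a j) (poincareInv (mo j).1 (mo j).2 x))} ⊆ (U : Set E4) ∧ range Φ ⊆ 𝒟.metric.causalFuture 𝒟.timeOrientation (range 𝒟.embed) ∧ 𝒟.metric.IsAchronal 𝒟.timeOrientation (Φ '' {x : ↥U | (x : E4) 0 = τ}) ∧ (∀ i, supCkENorm {x : E4 | x 0 = τ ∧ (∀ j, r₀ j < Kerr.radius (a j) (poincareInv (mo j).1 (mo j).2 x)) ∧ Kerr.radius (a i) (poincareInv (mo i).1 (mo i).2 x) ≤ R i} k (𝒟.toSpacetime.deviationExtend ⟨U, boostedKerrBilin (mo i).1 (mo i).2 (M i) (a i), fun x ↦ x 0, fun x ↦ Kerr.radius (a i) (poincareInv (mo i).1 (mo i).2 x)⟩ Φ) ≤ ENNReal.ofReal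 ε) ∧ supCkENorm {x : E4 | x 0 = τ ∧ (∀ j, r₀ j < Kerr.radius (a j) (poincareInv (mo j).1 (mo j).2 x)) ∧ ∀ j, R j - 1 ≤ Kerr.radius (a j) (poincareInv (mo j).1 (mo j).2 x)} k (𝒟.toSpacetime.deviationExtend (Minkowski.backgroundOn U) Φ) ≤ ENNReal.ofReal ε ∧ (∀ x : ↥U, x.1 0 = τ → (∀ j, R j - 1 ≤ Kerr.radius (a j) (poincareInv (mo j).1 (mo j).2 x.1)) → 𝒟.timeOrientation.IsFutureDirected (mfderiv 𝓘(ℝ, E4) (𝓡 4) Φ x (E4.basisVector 0))))) → ∃ (e' : AFEnd X) (F' : EuclideanSpace ℝ (Fin 1) → InitialDataSet (𝓡 3) X), InitialDataSet.IsTameDataFamily e' 1 F' ∧ F' 0 = F 0 ∧ Injective F' ∧ InitialDataSet.IsImmersedAtZero 1 F' ∧ (∀ c, F' c ∈ admissibleVacuumData X) ∧ ∀ c ≠ 0, (∀ 𝒟 : VacuumCauchyDevelopment (F' c), 𝒟.IsMaximal → Summit.FinalStateConjecture.HasCompleteNullInfinity 𝒟.toCauchyDevelopment ∧ (∃ (N₀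 : ℕ) (m₀ χ μ v₀ L₀ : ℝ), 0 < m₀ ∧ χ < 1 ∧ 0 < μ ∧ 0 < v₀ ∧ ∀ ε : ℝ, 0 < ε → ∃ (N : ℕ) (M a r₀ : Fin N → ℝ) (mo : Fin N → ↥lorentzGroup × E4), (N ≤ N₀ ∧ (∀ i, m₀ ≤ M i ∧ M i ≤ m₀⁻¹ ∧ |a i| ≤ χ * M i ∧ Kerr.rMinus (M i) (a i) + μ ≤ r₀ i ∧ r₀ i + μ ≤ Kerr.rPlus (M i) (a i) ∧ ∀ v : E4, ‖((mo i).1 : E4 ≃L[ℝ] E4) v‖ ≤ L₀ * ‖v‖) ∧ (∀ i j, i ≠ j → v₀ ≤ ‖(((mo i).1 : E4 ≃L[ℝ] E4) (E4.basisVector 0) 0)⁻¹ • E4.spatial (((mo i).1 : E4 ≃L[ℝ] E4) (E4.basisVector 0)) - (((mo j).1 : E4 ≃L[ℝ] E4) (E4.basisVector 0) 0)⁻¹ • E4.spatial (((mo j).1 : E4 ≃L[ℝ] E4) (E4.basisVector 0))‖)) ∧ ∀ τ₁ : ℝ, ∃ τ : ℝ, τ₁ ≤ τ ∧ ∃ (R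 : Fin N → ℝ) (U : Opens E4) (Φ : U → 𝒟.carrier), (∀ i, r₀ i + 1 ≤ R i) ∧ ContMDiff 𝓘(ℝ, E4) (𝓡 4) (⊤ : ℕ∞) Φ ∧ Topology.IsOpenEmbedding Φ ∧ {x : E4 | x 0 = τ ∧ (∀ j, r₀ j < Kerr.radius (a j) (poincareInv (mo j).1 (mo j).2 x))} ⊆ (U : Set E4) ∧ range Φ ⊆ 𝒟.metric.causalFuture 𝒟.timeOrientation (range 𝒟.embed) ∧ 𝒟.metric.IsAchronal 𝒟.timeOrientation (Φ '' {x : ↥U | (x : E4) 0 = τ}) ∧ (∀ i, supCkENorm {x : E4 | x 0 = τ ∧ (∀ j, r₀ j < Kerr.radius (a j) (poincareInv (mo j).1 (mo j).2 x)) ∧ Kerr.radius (a i) (poincareInv (mo i).1 (mo i).2 x) ≤ R i} k (𝒟.toSpacetime.deviationExtend ⟨U, boostedKerrBilin (mo i).1 (mo i).2 (M i) (a i), fun x ↦ x 0, fun x ↦ Kerr.radius (a i) (poincareInv (mo i).1 (mo i).2 x)⟩ Φ) ≤ ENNReal.ofReal ε) ∧ supCkENorm {x : E4 | x 0 = τ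 ∧ (∀ j, r₀ j < Kerr.radius (a j) (poincareInv (mo j).1 (mo j).2 x)) ∧ ∀ j, R j - 1 ≤ Kerr.radius (a j) (poincareInv (mo j).1 (mo j).2 x)} k (𝒟.toSpacetime.deviationExtend (Minkowski.backgroundOn U) Φ) ≤ ENNReal.ofReal ε ∧ (∀ x : ↥U, x.1 0 = τ → (∀ j, R j - 1 ≤ Kerr.radius (a j) (poincareInv (mo j).1 (mo j).2 x.1)) → 𝒟.timeOrientation.IsFutureDirected (mfderiv 𝓘(ℝ, E4) (𝓡 4) Φ x (E4.basisVector 0))))) := by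
  sorry

/-- stub 2b (rev 13) — THE INTERIOR LEMMA ALONG RECURRENT CURVES: for every `k`, `X`, every end `e` and every tame
curve `F` of admissible data on `e` — immersed at `0` and injective, or constant — whose members off `0` satisfy `P₁ k`
(censored AND recurrent) and whose base datum is EXCEPTIONAL for `Q_k = P₁ k ∧ interior lemma` ("every honest `C²` Kerr
decomposition `(O, d)` of every MGHD — sub-extremal holes, `O = exteriorOf`, exhaustive future-oriented charts — keeps every
future-complete normalised null ray from `Σ` in `closure O`"), there pass an end `e'` and a tame, injective, immersed curve
`F'` of admissible data through `F 0` whose members off `0` satisfy `Q_k`. Given stubs 1 and 2a this is EQUIVALENT to tame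
genericity of `Q_k`, i.e. to the birth skeleton's single stub: "generically, an honestly charted exterior hides no
future-complete null ray from `Σ`" (strong-censorship flavoured: black-hole interiors of generic censored, settling
developments are totally incomplete). Generic-only and TOPOLOGY-SENSITIVE (the crux quantifies over all one-ended `X`):
a bag-of-gold datum — an AF end glued through a throat to an eternally expanding vacuum region — would settle honestly
outside while hiding complete rays inside; open problem. -/
theorem stub_interiorLemmaAlongRecurrentCurves : ∀ k : ℕ, ∀ (X : Type) [TopologicalSpace X] [ChartedSpace E3 X] [IsManifold (𝓡 3) (⊤ : ℕ∞) X] [T2Space X] [SecondCountableTopology X] [ConnectedSpace X] (e : AFEnd X) (F : EuclideanSpace ℝ (Fin 1) → InitialDataSet (𝓡 3) X), InitialDataSet.IsTameDataFamily e 1 F → ((InitialDataSet.IsImmersedAtZero 1 F ∧ Injective F) ∨ ∀ c, F c = F 0) → (∀ c, F c ∈ admissibleVacuumData X) → (∀ c ≠ 0, (∀ 𝒟 : VacuumCauchyDevelopment (F c), 𝒟.IsMaximal → Summit.FinalStateConjecture.HasCompleteNullInfinity 𝒟.toCauchyDevelopment ∧ (∃ (N₀ : ℕ) (m₀ χ μ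 v₀ L₀ : ℝ), 0 < m₀ ∧ χ < 1 ∧ 0 < μ ∧ 0 < v₀ ∧ ∀ ε : ℝ, 0 < ε → ∃ (N : ℕ) (M a r₀ : Fin N → ℝ) (mo : Fin N → ↥lorentzGroup × E4), (N ≤ N₀ ∧ (∀ i, m₀ ≤ M i ∧ M i ≤ m₀⁻¹ ∧ |a i| ≤ χ * M i ∧ Kerr.rMinus (M i) (a i) + μ ≤ r₀ i ∧ r₀ i + μ ≤ Kerr.rPlus (M i) (a i) ∧ ∀ v : E4, ‖((mo i).1 : E4 ≃L[ℝ] E4) v‖ ≤ L₀ * ‖v‖) ∧ (∀ i j, i ≠ j → v₀ ≤ ‖(((mo i).1 : E4 ≃L[ℝ] E4) (E4.basisVector 0) 0)⁻¹ • E4.spatial (((mo i).1 : E4 ≃L[ℝ] E4) (E4.basisVector 0)) - (((mo j).1 : E4 ≃L[ℝ] E4) (E4.basisVector 0) 0)⁻¹ • E4.spatial (((mo j).1 : E4 ≃L[ℝ] E4) (E4.basisVector 0))‖)) ∧ ∀ τ₁ : ℝ, ∃ τ : ℝ, τ₁ ≤ τ ∧ ∃ (R : Fin N → ℝ) (U :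 Opens E4) (Φ : U → 𝒟.carrier), (∀ i, r₀ i + 1 ≤ R i) ∧ ContMDiff 𝓘(ℝ, E4) (𝓡 4) (⊤ : ℕ∞) Φ ∧ Topology.IsOpenEmbedding Φ ∧ {x : E4 | x 0 = τ ∧ (∀ j, r₀ j < Kerr.radius (a j) (poincareInv (mo j).1 (mo j).2 x))} ⊆ (U : Set E4) ∧ range Φ ⊆ 𝒟.metric.causalFuture 𝒟.timeOrientation (range 𝒟.embed) ∧ 𝒟.metric.IsAchronal 𝒟.timeOrientation (Φ '' {x : ↥U | (x : E4) 0 = τ}) ∧ (∀ i, supCkENorm {x : E4 | x 0 = τ ∧ (∀ j, r₀ j < Kerr.radius (a j) (poincareInv (mo j).1 (mo j).2 x)) ∧ Kerr.radius (a i) (poincareInv (mo i).1 (mo i).2 x) ≤ R i} k (𝒟.toSpacetime.deviationExtend ⟨U, boostedKerrBilin (mo i).1 (mo i).2 (M i) (a i), fun x ↦ x 0, fun x ↦ Kerr.radius (a i) (poincareInv (mo i).1 (mo i).2 x)⟩ Φ) ≤ ENNReal.ofReal ε) ∧ supCkENorm {x : E4 | x 0 = τ ∧ (∀ j, r₀ j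 < Kerr.radius (a j) (poincareInv (mo j).1 (mo j).2 x)) ∧ ∀ j, R j - 1 ≤ Kerr.radius (a j) (poincareInv (mo j).1 (mo j).2 x)} k (𝒟.toSpacetime.deviationExtend (Minkowski.backgroundOn U) Φ) ≤ ENNReal.ofReal ε ∧ (∀ x : ↥U, x.1 0 = τ → (∀ j, R j - 1 ≤ Kerr.radius (a j) (poincareInv (mo j).1 (mo j).2 x.1)) → 𝒟.timeOrientation.IsFutureDirected (mfderiv 𝓘(ℝ, E4) (𝓡 4) Φ x (E4.basisVector 0)))))) → ¬ (∀ 𝒟 : VacuumCauchyDevelopment (F 0), 𝒟.IsMaximal → Summit.FinalStateConjecture.HasCompleteNullInfinity 𝒟.toCauchyDevelopment ∧ (∃ (N₀ : ℕ) (m₀ χ μ v₀ L₀ : ℝ), 0 < m₀ ∧ χ < 1 ∧ 0 < μ ∧ 0 < v₀ ∧ ∀ ε : ℝ, 0 < ε → ∃ (N : ℕ) (M a r₀ : Fin N → ℝ) (mo : Fin N → ↥lorentzGroup × E4), (N ≤ N₀ ∧ (∀ i, m₀ ≤ M i ∧ M i ≤ m₀⁻¹ ∧ |a i| ≤ χ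 * M i ∧ Kerr.rMinus (M i) (a i) + μ ≤ r₀ i ∧ r₀ i + μ ≤ Kerr.rPlus (M i) (a i) ∧ ∀ v : E4, ‖((mo i).1 : E4 ≃L[ℝ] E4) v‖ ≤ L₀ * ‖v‖) ∧ (∀ i j, i ≠ j → v₀ ≤ ‖(((mo i).1 : E4 ≃L[ℝ] E4) (E4.basisVector 0) 0)⁻¹ • E4.spatial (((mo i).1 : E4 ≃L[ℝ] E4) (E4.basisVector 0)) - (((mo j).1 : E4 ≃L[ℝ] E4) (E4.basisVector 0) 0)⁻¹ • E4.spatial (((mo j).1 : E4 ≃L[ℝ] E4) (E4.basisVector 0))‖)) ∧ ∀ τ₁ : ℝ, ∃ τ : ℝ, τ₁ ≤ τ ∧ ∃ (R : Fin N → ℝ) (U : Opens E4) (Φ : U → 𝒟.carrier), (∀ i, r₀ i + 1 ≤ R i) ∧ ContMDiff 𝓘(ℝ, E4) (𝓡 4) (⊤ : ℕ∞) Φ ∧ Topology.IsOpenEmbedding Φ ∧ {x : E4 | x 0 = τ ∧ (∀ j, r₀ j < Kerr.radius (a j) (poincareInv (mo j).1 (mo j).2 x))} ⊆ (U : Set E4)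 ∧ range Φ ⊆ 𝒟.metric.causalFuture 𝒟.timeOrientation (range 𝒟.embed) ∧ 𝒟.metric.IsAchronal 𝒟.timeOrientation (Φ '' {x : ↥U | (x : E4) 0 = τ}) ∧ (∀ i, supCkENorm {x : E4 | x 0 = τ ∧ (∀ j, r₀ j < Kerr.radius (a j) (poincareInv (mo j).1 (mo j).2 x)) ∧ Kerr.radius (a i) (poincareInv (mo i).1 (mo i).2 x) ≤ R i} k (𝒟.toSpacetime.deviationExtend ⟨U, boostedKerrBilin (mo i).1 (mo i).2 (M i) (a i), fun x ↦ x 0, fun x ↦ Kerr.radius (a i) (poincareInv (mo i).1 (mo i).2 x)⟩ Φ) ≤ ENNReal.ofReal ε) ∧ supCkENorm {x : E4 | x 0 = τ ∧ (∀ j, r₀ j < Kerr.radius (a j) (poincareInv (mo j).1 (mo j).2 x)) ∧ ∀ j, R j - 1 ≤ Kerr.radius (a j) (poincareInv (mo j).1 (mo j).2 x)} k (𝒟.toSpacetime.deviationExtend (Minkowski.backgroundOn U) Φ) ≤ ENNReal.ofReal ε ∧ (∀ x : ↥U, x.1 0 = τ → (∀ j, R j - 1 ≤ Kerr.radius (a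 j) (poincareInv (mo j).1 (mo j).2 x.1)) → 𝒟.timeOrientation.IsFutureDirected (mfderiv 𝓘(ℝ, E4) (𝓡 4) Φ x (E4.basisVector 0)))) ∧ (∀ (O : Set 𝒟.carrier) (d : FinalStateDecomposition 𝒟.toSpacetime O 2), (∀ i, Kerr.IsSubextremal (d.mass i) (d.spin i)) → O = Summit.FinalStateConjecture.exteriorOf 𝒟.toCauchyDevelopment d.charted → Summit.FinalStateConjecture.HasExhaustiveCharts d → Summit.FinalStateConjecture.IsFutureOriented d → Summit.FinalStateConjecture.RaysStayInClosure 𝒟.toCauchyDevelopment O)) → ∃ (e' : AFEnd X) (F' : EuclideanSpace ℝ (Fin 1) → InitialDataSet (𝓡 3) X), InitialDataSet.IsTameDataFamily e' 1 F' ∧ F' 0 = F 0 ∧ Injective F' ∧ InitialDataSet.IsImmersedAtZero 1 F' ∧ (∀ c, F' c ∈ admissibleVacuumData X) ∧ ∀ c ≠ 0, (∀ 𝒟 : VacuumCauchyDevelopment (F' c), 𝒟.IsMaximal → Summit.FinalStateConjecture.HasCompleteNullInfinity 𝒟.toCauchyDevelopment ∧ (∃ (N₀ : ℕ) (m₀ χ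 μ v₀ L₀ : ℝ), 0 < m₀ ∧ χ < 1 ∧ 0 < μ ∧ 0 < v₀ ∧ ∀ ε : ℝ, 0 < ε → ∃ (N : ℕ) (M a r₀ : Fin N → ℝ) (mo : Fin N → ↥lorentzGroup × E4), (N ≤ N₀ ∧ (∀ i, m₀ ≤ M i ∧ M i ≤ m₀⁻¹ ∧ |a i| ≤ χ * M i ∧ Kerr.rMinus (M i) (a i) + μ ≤ r₀ i ∧ r₀ i + μ ≤ Kerr.rPlus (M i) (a i) ∧ ∀ v : E4, ‖((mo i).1 : E4 ≃L[ℝ] E4) v‖ ≤ L₀ * ‖v‖) ∧ (∀ i j, i ≠ j → v₀ ≤ ‖(((mo i).1 : E4 ≃L[ℝ] E4) (E4.basisVector 0) 0)⁻¹ • E4.spatial (((mo i).1 : E4 ≃L[ℝ] E4) (E4.basisVector 0)) - (((mo j).1 : E4 ≃L[ℝ] E4) (E4.basisVector 0) 0)⁻¹ • E4.spatial (((mo j).1 : E4 ≃L[ℝ] E4) (E4.basisVector 0))‖)) ∧ ∀ τ₁ : ℝ, ∃ τ : ℝ, τ₁ ≤ τ ∧ ∃ (R : Fin N → ℝ) (U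 : Opens E4) (Φ : U → 𝒟.carrier), (∀ i, r₀ i + 1 ≤ R i) ∧ ContMDiff 𝓘(ℝ, E4) (𝓡 4) (⊤ : ℕ∞) Φ ∧ Topology.IsOpenEmbedding Φ ∧ {x : E4 | x 0 = τ ∧ (∀ j, r₀ j < Kerr.radius (a j) (poincareInv (mo j).1 (mo j).2 x))} ⊆ (U : Set E4) ∧ range Φ ⊆ 𝒟.metric.causalFuture 𝒟.timeOrientation (range 𝒟.embed) ∧ 𝒟.metric.IsAchronal 𝒟.timeOrientation (Φ '' {x : ↥U | (x : E4) 0 = τ}) ∧ (∀ i, supCkENorm {x : E4 | x 0 = τ ∧ (∀ j, r₀ j < Kerr.radius (a j) (poincareInv (mo j).1 (mo j).2 x)) ∧ Kerr.radius (a i) (poincareInv (mo i).1 (mo i).2 x) ≤ R i} k (𝒟.toSpacetime.deviationExtend ⟨U, boostedKerrBilin (mo i).1 (mo i).2 (M i) (a i), fun x ↦ x 0, fun x ↦ Kerr.radius (a i) (poincareInv (mo i).1 (mo i).2 x)⟩ Φ) ≤ ENNReal.ofReal ε) ∧ supCkENorm {x : E4 | x 0 = τ ∧ (∀ j, r₀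 j < Kerr.radius (a j) (poincareInv (mo j).1 (mo j).2 x)) ∧ ∀ j, R j - 1 ≤ Kerr.radius (a j) (poincareInv (mo j).1 (mo j).2 x)} k (𝒟.toSpacetime.deviationExtend (Minkowski.backgroundOn U) Φ) ≤ ENNReal.ofReal ε ∧ (∀ x : ↥U, x.1 0 = τ → (∀ j, R j - 1 ≤ Kerr.radius (a j) (poincareInv (mo j).1 (mo j).2 x.1)) → 𝒟.timeOrientation.IsFutureDirected (mfderiv 𝓘(ℝ, E4) (𝓡 4) Φ x (E4.basisVector 0)))) ∧ (∀ (O : Set 𝒟.carrier) (d : FinalStateDecomposition 𝒟.toSpacetime O 2), (∀ i, Kerr.IsSubextremal (d.mass i) (d.spin i)) → O = Summit.FinalStateConjecture.exteriorOf 𝒟.toCauchyDevelopment d.charted → Summit.FinalStateConjecture.HasExhaustiveCharts d → Summit.FinalStateConjecture.IsFutureOriented d → Summit.FinalStateConjecture.RaysStayInClosure 𝒟.toCauchyDevelopment O)) := by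
  sorry

/-- stub T1 — COMPACTNESS OF THE MARGIN FAMILY (pure finite-dimensional topology, no spacetime):
a sequence `s` of multi-Kerr configurations `(N; M, a, r₀; mo)` (a `Σ`-type over the hole count)
all lying in one margin family `(N₀, m₀, χ, μ, v₀, L₀)` has a subsequence `s ∘ φ` with CONSTANT hole
count `N` along which masses, spins, inner radii converge in `ℝ` and the boosts converge in operator
norm together with their inverses, to a limit `(Mₗ, aₗ, rₗ, moₗ)` (the centres `(moₗ i).2` are
arbitrary) which again lies in the margin family (closed conditions; `(Λ e₀)⁰ ≠ 0` on the Lorentz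
group keeps the lab velocities continuous). Pigeonhole on `N ≤ N₀`, Bolzano–Weierstrass in
`ℝ^{{3N}} × (E4 →L[ℝ] E4)^N` (`‖Λ‖ ≤ L₀`, `M ∈ [m₀, m₀⁻¹]`, `|a| ≤ χM`, `r₀ ∈ [r₋ + μ, r₊ − μ] ⊆ [M − |M| + μ, M + |M| − μ]`),
closedness of `lorentzGroup` in `E4 →L[ℝ] E4` and continuity of inversion at invertible maps. -/
theorem stub_marginCompactness : ∀ (N₀ : ℕ) (m₀ χ μ v₀ L₀ : ℝ) (s : ℕ → (Σ N : ℕ, (Fin N → ℝ) × (Fin N → ℝ) × (Fin N → ℝ) × (Fin N → ↥lorentzGroup × E4))), (∀ n, (s n).1 ≤ N₀ ∧ (∀ i, m₀ ≤ (s n).2.1 i ∧ (s n).2.1 i ≤ m₀⁻¹ ∧ |(s n).2.2.1 i| ≤ χ * (s n).2.1 i ∧ Kerr.rMinus ((s n).2.1 i) ((s n).2.2.1 i) + μ ≤ (s n).2.2.2.1 i ∧ (s n).2.2.2.1 i + μ ≤ Kerr.rPlus ((s n).2.1 i) ((s n).2.2.1 i) ∧ ∀ v : E4, ‖(((s n).2.2.2.2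 i).1 : E4 ≃L[ℝ] E4) v‖ ≤ L₀ * ‖v‖) ∧ (∀ i j, i ≠ j → v₀ ≤ ‖((((s n).2.2.2.2 i).1 : E4 ≃L[ℝ] E4) (E4.basisVector 0) 0)⁻¹ • E4.spatial ((((s n).2.2.2.2 i).1 : E4 ≃L[ℝ] E4) (E4.basisVector 0)) - ((((s n).2.2.2.2 j).1 : E4 ≃L[ℝ] E4) (E4.basisVector 0) 0)⁻¹ • E4.spatial ((((s n).2.2.2.2 j).1 : E4 ≃L[ℝ] E4) (E4.basisVector 0))‖)) → ∃ (N : ℕ) (M a r₀ : ℕ → Fin N → ℝ) (mo : ℕ → Fin N → ↥lorentzGroup × E4) (φ : ℕ → ℕ) (Mₗ aₗ rₗ : Fin N → ℝ) (moₗ : Fin N → ↥lorentzGroup × E4), StrictMono φ ∧ (∀ n, s (φ n) = ⟨N, M n, a n, r₀ n, mo n⟩) ∧ (∀ i, Tendsto (fun n ↦ M n i) atTop (𝓝 (Mₗ i))) ∧ (∀ i, Tendsto (fun n ↦ a n i) atTop (𝓝 (aₗ i))) ∧ (∀ i, Tendsto (fun n ↦ r₀ n i) atTop (𝓝 (rₗ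 i))) ∧ (∀ i, Tendsto (fun n ↦ (((mo n i).1 : E4 ≃L[ℝ] E4) : E4 →L[ℝ] E4)) atTop (𝓝 (((moₗ i).1 : E4 ≃L[ℝ] E4) : E4 →L[ℝ] E4))) ∧ (∀ i, Tendsto (fun n ↦ (((mo n i).1 : E4 ≃L[ℝ] E4).symm : E4 →L[ℝ] E4)) atTop (𝓝 (((moₗ i).1 : E4 ≃L[ℝ] E4).symm : E4 →L[ℝ] E4))) ∧ (N ≤ N₀ ∧ (∀ i, m₀ ≤ Mₗ i ∧ Mₗ i ≤ m₀⁻¹ ∧ |aₗ i| ≤ χ * Mₗ i ∧ Kerr.rMinus (Mₗ i) (aₗ i) + μ ≤ rₗ i ∧ rₗ i + μ ≤ Kerr.rPlus (Mₗ i) (aₗ i) ∧ ∀ v : E4, ‖((moₗ i).1 : E4 ≃L[ℝ] E4) v‖ ≤ L₀ * ‖v‖) ∧ (∀ i j, i ≠ j → v₀ ≤ ‖(((moₗ i).1 : E4 ≃L[ℝ] E4) (E4.basisVector 0) 0)⁻¹ • E4.spatial (((moₗ i).1 : E4 ≃L[ℝ] E4) (E4.basisVector 0)) - (((moₗ j).1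 : E4 ≃L[ℝ] E4) (E4.basisVector 0) 0)⁻¹ • E4.spatial (((moₗ j).1 : E4 ≃L[ℝ] E4) (E4.basisVector 0))‖)) :=
  -- LANDED p149657 (wave 1): the registered stub, proved in the tree under the worker's namespace
  Summit.FinalStateConjecture.FinalStateConjecture.Theorems.KerrnessPropagates.KerrBasinCapture.stub_marginCompactness

/-- stub T2a — SMALL ACCURACY FORCES LARGE NEAR ZONES (uniform in the margin family; `C⁰` only):
for margins with `0 < m₀`, `χ < 1`, `0 < μ`, `0 < v₀` and every `R₁` there is `ε₀ > 0` such that for every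
configuration in the margins, beyond a lab time `T` (depending on the configuration, centres
included), every hand-over slab at accuracy `ε ≤ ε₀` has all its near-zone radii `Rⱼ ≥ R₁`. Proof idea:
if `Rⱼ < R₁`, evaluate at the lab point of `{x⁰ = τ}` sitting on hole `j`'s rest-frame polar axis at
Kerr–Schild radius `Rⱼ` (`KerrSchildChart.radius_polar`): it lies in near disc `j` (`Rⱼ > r₀ⱼ`) and,
for `τ` large (strict recession puts the other holes at lab distance `≥ v₀τ/C`), either in the far
zone or in another near disc `i` at radius `≳ τ`, where `Kerrᵢ − η = O(Mᵢ/rᵢ)`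
(`Kerr.scalarH_le_div`, `norm_boostedKerrBilin_sub_minkowski_le`); so `‖Kerrⱼ − η‖ ≤ 2ε + O(1/τ)` there,
against the lower bound `‖boostedKerrⱼ − η‖ ≥ 2H/‖Λⱼ‖² ≥ 2 m₀ min(1/(1+m₀⁻²), R₁/(R₁²+m₀⁻²))/L₀²`
(`Kerr.ksPert_eq`, `nullCovector_basisVector_zero`, `H = M r/(r² + a²)` on the axis). -/
theorem stub_largeNearZones : ∀ k : ℕ, ∀ (X : Type) [TopologicalSpace X] [ChartedSpace E3 X] [IsManifold (𝓡 3) (⊤ : ℕ∞) X] [T2Space X] [SecondCountableTopology X] [ConnectedSpace X] (D : InitialDataSet (𝓡 3) X) (𝒟 : VacuumCauchyDevelopment D) (N₀ : ℕ) (m₀ χ μ v₀ L₀ : ℝ), 0 < m₀ → χ < 1 → 0 < μ → 0 < v₀ → ∀ R₁ : ℝ, ∃ ε₀ : ℝ, 0 < ε₀ ∧ ∀ (N : ℕ) (M a r₀ : Fin N → ℝ) (mo : Fin N → ↥lorentzGroup × E4), (N ≤ N₀ ∧ (∀ i, m₀ ≤ M i ∧ M i ≤ m₀⁻¹ ∧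 |a i| ≤ χ * M i ∧ Kerr.rMinus (M i) (a i) + μ ≤ r₀ i ∧ r₀ i + μ ≤ Kerr.rPlus (M i) (a i) ∧ ∀ v : E4, ‖((mo i).1 : E4 ≃L[ℝ] E4) v‖ ≤ L₀ * ‖v‖) ∧ (∀ i j, i ≠ j → v₀ ≤ ‖(((mo i).1 : E4 ≃L[ℝ] E4) (E4.basisVector 0) 0)⁻¹ • E4.spatial (((mo i).1 : E4 ≃L[ℝ] E4) (E4.basisVector 0)) - (((mo j).1 : E4 ≃L[ℝ] E4) (E4.basisVector 0) 0)⁻¹ • E4.spatial (((mo j).1 : E4 ≃L[ℝ] E4) (E4.basisVector 0))‖)) → ∃ T : ℝ, ∀ τ : ℝ, T ≤ τ → ∀ ε : ℝ, 0 < ε → ε ≤ ε₀ → ∀ (R : Fin N → ℝ) (U : Opens E4) (Φ : U → 𝒟.carrier), ((∀ i, r₀ i + 1 ≤ R i) ∧ ContMDiff 𝓘(ℝ, E4) (𝓡 4) (⊤ : ℕ∞) Φ ∧ Topology.IsOpenEmbedding Φ ∧ {x : E4 | x 0 = τ ∧ (∀ j, r₀ j < Kerr.radius (a j) (poincareInv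 (mo j).1 (mo j).2 x))} ⊆ (U : Set E4) ∧ range Φ ⊆ 𝒟.metric.causalFuture 𝒟.timeOrientation (range 𝒟.embed) ∧ 𝒟.metric.IsAchronal 𝒟.timeOrientation (Φ '' {x : ↥U | (x : E4) 0 = τ}) ∧ (∀ i, supCkENorm {x : E4 | x 0 = τ ∧ (∀ j, r₀ j < Kerr.radius (a j) (poincareInv (mo j).1 (mo j).2 x)) ∧ Kerr.radius (a i) (poincareInv (mo i).1 (mo i).2 x) ≤ R i} k (𝒟.toSpacetime.deviationExtend ⟨U, boostedKerrBilin (mo i).1 (mo i).2 (M i) (a i), fun x ↦ x 0, fun x ↦ Kerr.radius (a i) (poincareInv (mo i).1 (mo i).2 x)⟩ Φ) ≤ ENNReal.ofReal ε) ∧ supCkENorm {x : E4 | x 0 = τ ∧ (∀ j, r₀ j < Kerr.radius (a j) (poincareInv (mo j).1 (mo j).2 x)) ∧ ∀ j, R j - 1 ≤ Kerr.radius (a j) (poincareInv (mo j).1 (mo j).2 x)} k (𝒟.toSpacetime.deviationExtend (Minkowski.backgroundOn U) Φ) ≤ ENNReal.ofReal ε ∧ (∀ x : ↥U, x.1 0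 = τ → (∀ j, R j - 1 ≤ Kerr.radius (a j) (poincareInv (mo j).1 (mo j).2 x.1)) → 𝒟.timeOrientation.IsFutureDirected (mfderiv 𝓘(ℝ, E4) (𝓡 4) Φ x (E4.basisVector 0)))) → ∀ j, R₁ ≤ R j :=
  -- LANDED p151854 (wave 1): the registered stub, proved in the tree under the worker's namespace
  Summit.FinalStateConjecture.FinalStateConjecture.Theorems.KerrnessPropagates.KerrBasinCapture.stub_largeNearZones

/-- stub T2b — DIRECTION DODGING (pure Euclidean geometry of `E3 = ℝ³`): from a point `z` at distance
`≥ D ≥ 32 (N+1) ρ` from each of `N` centres `Xᵢ`, some unit direction `e` has its ray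
`{z + s e : s ≥ 0}` at distance `≥ ρ` from every centre. Proof idea: a ray from `z` meeting the ball
`B(Xᵢ, ρ)` has direction within `4ρ/D` of `(Xᵢ − z)/‖Xᵢ − z‖`, so two blocked directions of the same
ball are within `8ρ/D ≤ 1/(4(N+1))`; the `N + 1` unit vectors `(cos(2πm/(N+1)), sin(2πm/(N+1)), 0)` are
pairwise `≥ 2 sin(π/(N+1)) ≥ 4/(N+1)` apart (Jordan, `Real.mul_le_sin`), so by pigeonhole one of them is
blocked by no ball. -/
theorem stub_directionDodging : ∀ (N : ℕ) (X : Fin N → E3) (z : E3) (ρ D : ℝ), 0 < ρ → 32 * ((N : ℝ) + 1) * ρ ≤ D → (∀ i, D ≤ ‖z - X i‖) → ∃ e : E3, ‖e‖ = 1 ∧ ∀ i, ∀ s : ℝ, 0 ≤ s → ρ ≤ ‖z + s • e - X i‖ :=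
  -- LANDED p152513 (wave 1): the registered stub, proved in the tree under the worker's namespace
  Summit.FinalStateConjecture.FinalStateConjecture.Theorems.KerrnessPropagates.KerrBasinCapture.stub_directionDodging

/-- stub T2c — CONTINUITY OF THE RE-ANCHORED KERR–SCHILD FAMILY ON STATIONARY SHELLS: if labels
`(Mₙ, aₙ) → (Mₗ, aₗ)` and frame maps `Tₙ → Λₗ⁻¹` in operator norm, each `Tₙ` mapping the limit
4-velocity `Λₗ e₀` into `ℝ e₀`, then the `Cᵏ` distance on the (unbounded, stationary) shell
`{ρ₁ ≤ rₗ ≤ ρ₂}` of the limit hole between the re-anchored form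
`x ↦ (precomp Tₙ) ∘ Kerr_{Mₙ,aₙ}(Tₙ(x − cₗ)) ∘ Tₙ` and `boostedKerrBilin Λₗ cₗ Mₗ aₗ` tends to `0`.
Proof idea: both are invariant under `x ↦ x + s Λₗ e₀` (`Kerr.bilin_add_smul_basisVector_zero`,
`KerrSchildChart.boostedKerrBilin_add_smul`, `iteratedFDeriv_comp_add_right`), so the shell reduces to
the compact fundamental piece `{(poincareInv Λₗ cₗ x)⁰ ∈ [0, 1]}`; there apply the parametric Lipschitz
bound `ClusterCompleteness.exists_norm_iteratedFDeriv_precomp_kerrBilin_sub_le` (MotionRebase) on a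
small compact convex parameter ball around `((Mₗ, aₗ), (Λₗ⁻¹, cₗ))` on which the Kerr–Schild radius
stays positive (`isOpen_setOf_radius_param_pos`, `ρ₁ > 0`), with `boostedKerrBilin_eq_precomp_kerrBilin`. -/
theorem stub_kerrFamilyContinuity : ∀ (k : ℕ) (Mseq aseq : ℕ → ℝ) (Tseq : ℕ → E4 →L[ℝ] E4) (Mₗ aₗ : ℝ) (Λₗ : ↥lorentzGroup) (cₗ : E4) (ρ₁ ρ₂ : ℝ), 0 < ρ₁ → Tendsto Mseq atTop (𝓝 Mₗ) → Tendsto aseq atTop (𝓝 aₗ) → Tendsto Tseq atTop (𝓝 ((Λₗ : E4 ≃L[ℝ] E4).symm : E4 →L[ℝ] E4)) → (∀ n, ∃ κ : ℝ, Tseq n ((Λₗ : E4 ≃L[ℝ] E4) (E4.basisVector 0)) = κ • E4.basisVector 0) → ∀ δ : ℝ, 0 < δ → ∀ᶠ n in atTop, ∀ i ≤ k, ∀ x : E4, ρ₁ ≤ Kerr.radius aₗ (poincareInv Λₗ cₗ x) → Kerr.radius aₗ (poincareInv Λₗ cₗ x) ≤ ρ₂ → ‖iteratedFDeriv ℝ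 i (fun z ↦ (ContinuousLinearMap.precomp ℝ (Tseq n)).comp ((Kerr.bilin (Mseq n) (aseq n) (Tseq n (z - cₗ))).comp (Tseq n))) x - iteratedFDeriv ℝ i (boostedKerrBilin Λₗ cₗ Mₗ aₗ) x‖ ≤ δ :=
  -- LANDED p153196 (wave 1): the registered stub, proved in the tree under the worker's namespace
  Summit.FinalStateConjecture.FinalStateConjecture.Theorems.KerrnessPropagates.KerrBasinCapture.stub_kerrFamilyContinuity

/-- stub G — UNIFORM BOOSTED KERR–SCHILD DECAY: for `k`, `m₀ > 0`, `χ`, `L₀` there are `C`, `R₀ > 0` with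
`‖Dᵐ(boostedKerrBilin Λ c M a − η)(x)‖ ≤ C / r` for all `m ≤ k`, all `r = Kerr.radius a (poincareInv Λ c x) ≥ R₀`,
uniformly over `M ∈ [m₀, m₀⁻¹]`, `|a| ≤ χ M`, `‖Λ v‖ ≤ L₀‖v‖`, all centres `c`. Proof idea: the fixed-parameter
statement is `norm_iteratedFDeriv_boostedKsPert_le`; uniformity from the scaling identity `boostedKsPert_smul`
(reduce to `M = 1`, `|a'| ≤ χ`, unit spatial sphere in the rest frame after `poincareInv`), stationarity
`iteratedFDeriv_boostedKsPert_add_smul`, joint smoothness in `((M, a), (L, c), x)`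
(`ClusterCompleteness.contDiffAt_precomp_kerrBilin_param`, `isOpen_setOf_radius_param_pos`) hence continuity of
`(L, a', y) ↦ Dᵐ(…)` (`Literature.Analysis.Calculus.contDiffAt_iteratedFDeriv_parametric`) on the compact set
`{Lorentz L, ‖L‖ ≤ L₀} × [−χ', χ'] × {y⁰ = 0, ‖y̲‖ = 1}` (`isCompact_lorentzBall`). -/
theorem stub_uniformBoostedKerrDecay : ∀ (k : ℕ) (m₀ χ L₀ : ℝ), 0 < m₀ → ∃ C R₀ : ℝ, 0 < R₀ ∧ ∀ (M a : ℝ) (Λ : ↥lorentzGroup) (c : E4), m₀ ≤ M → M ≤ m₀⁻¹ → |a| ≤ χ * M → (∀ v : E4, ‖(Λ : E4 ≃L[ℝ] E4) v‖ ≤ L₀ * ‖v‖) → ∀ x : E4, R₀ ≤ Kerr.radius a (poincareInv Λ c x) → ∀ m ≤ k, ‖iteratedFDeriv ℝ m (fun y ↦ boostedKerrBilin Λ c M a y - Minkowski.bilin) x‖ ≤ C / Kerr.radius a (poincareInv Λ c x) :=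
  -- LANDED p155686 (wave 2)
  Summit.FinalStateConjecture.FinalStateConjecture.Theorems.KerrnessPropagates.KerrBasinCapture.stub_uniformBoostedKerrDecay

/-- stub B — FAR-FIELD FLATNESS OF A HAND-OVER SLAB, GIVEN UNIFORM DECAY: at a point `z` of the slab
`{x⁰ = τ} ∖ inner discs` all of whose Kerr–Schild radii are `≥ ρ ≥ ρ₀`, every `Cᵐ` jet (`m ≤ k`) of
`deviationExtend (Minkowski.backgroundOn U) Φ` has norm `≤ ε + C/ρ`: either `z` lies in the far zone (the far
`supCkENorm` hypothesis, `enorm_iteratedFDeriv_le_supCkENorm`), or `rₗ(z) < Rₗ − 1` for some hole `l`, so `z` is in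
near disc `l`, where `dev_η = dev_{Kerrₗ} + (boostedKerrₗ − η)` near `z` (two backgrounds on the same domain `U`;
`deviationExtend_coe`, `Spacetime.deviation`; both summands smooth at `z`: `contDiffAt_deviationExtend_model`,
`contDiffAt_boostedKerrBilin`), and the two jets are bounded by the near `supCkENorm` hypothesis and by stub G. -/
theorem stub_farFieldFlatness : (∀ (k : ℕ) (m₀ χ L₀ : ℝ), 0 < m₀ → ∃ C R₀ : ℝ, 0 < R₀ ∧ ∀ (M a : ℝ) (Λ : ↥lorentzGroup) (c : E4), m₀ ≤ M → M ≤ m₀⁻¹ → |a| ≤ χ * M → (∀ v : E4, ‖(Λ : E4 ≃L[ℝ] E4) v‖ ≤ L₀ * ‖v‖) → ∀ x : E4, R₀ ≤ Kerr.radius a (poincareInv Λ c x) → ∀ m ≤ k, ‖iteratedFDeriv ℝ m (fun y ↦ boostedKerrBilin Λ c M a y - Minkowski.bilin) x‖ ≤ C / Kerr.radius a (poincareInv Λ c x)) → ∀ k : ℕ, ∀ (X : Type) [TopologicalSpace X] [ChartedSpace E3 X] [IsManifold (𝓡 3) (⊤ : ℕ∞) X] [T2Space X] [SecondCountableTopology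 X] [ConnectedSpace X] (D : InitialDataSet (𝓡 3) X) (𝒟 : VacuumCauchyDevelopment D) (N₀ : ℕ) (m₀ χ μ v₀ L₀ : ℝ), 0 < m₀ → ∃ C ρ₀ : ℝ, 0 < ρ₀ ∧ ∀ (N : ℕ) (M a r₀ : Fin N → ℝ) (mo : Fin N → ↥lorentzGroup × E4), (N ≤ N₀ ∧ (∀ i, m₀ ≤ M i ∧ M i ≤ m₀⁻¹ ∧ |a i| ≤ χ * M i ∧ Kerr.rMinus (M i) (a i) + μ ≤ r₀ i ∧ r₀ i + μ ≤ Kerr.rPlus (M i) (a i) ∧ ∀ v : E4, ‖((mo i).1 : E4 ≃L[ℝ] E4) v‖ ≤ L₀ * ‖v‖) ∧ (∀ i j, i ≠ j → v₀ ≤ ‖(((mo i).1 : E4 ≃L[ℝ] E4) (E4.basisVector 0) 0)⁻¹ • E4.spatial (((mo i).1 : E4 ≃L[ℝ] E4) (E4.basisVector 0)) - (((mo j).1 : E4 ≃L[ℝ] E4) (E4.basisVector 0) 0)⁻¹ • E4.spatial (((mo j).1 : E4 ≃L[ℝ] E4) (E4.basisVector 0))‖)) → ∀ (ε τ : ℝ)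 (R : Fin N → ℝ) (U : Opens E4) (Φ : U → 𝒟.carrier), 0 ≤ ε → ((∀ i, r₀ i + 1 ≤ R i) ∧ ContMDiff 𝓘(ℝ, E4) (𝓡 4) (⊤ : ℕ∞) Φ ∧ Topology.IsOpenEmbedding Φ ∧ {x : E4 | x 0 = τ ∧ (∀ j, r₀ j < Kerr.radius (a j) (poincareInv (mo j).1 (mo j).2 x))} ⊆ (U : Set E4) ∧ range Φ ⊆ 𝒟.metric.causalFuture 𝒟.timeOrientation (range 𝒟.embed) ∧ 𝒟.metric.IsAchronal 𝒟.timeOrientation (Φ '' {x : ↥U | (x : E4) 0 = τ}) ∧ (∀ i, supCkENorm {x : E4 | x 0 = τ ∧ (∀ j, r₀ j < Kerr.radius (a j) (poincareInv (mo j).1 (mo j).2 x)) ∧ Kerr.radius (a i) (poincareInv (mo i).1 (mo i).2 x) ≤ R i} k (𝒟.toSpacetime.deviationExtend ⟨U, boostedKerrBilin (mo i).1 (mo i).2 (M i) (a i), fun x ↦ x 0, fun x ↦ Kerr.radius (a i) (poincareInv (mo i).1 (mo i).2 x)⟩ Φ) ≤ ENNReal.ofReal ε) ∧ supCkENorm {x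 : E4 | x 0 = τ ∧ (∀ j, r₀ j < Kerr.radius (a j) (poincareInv (mo j).1 (mo j).2 x)) ∧ ∀ j, R j - 1 ≤ Kerr.radius (a j) (poincareInv (mo j).1 (mo j).2 x)} k (𝒟.toSpacetime.deviationExtend (Minkowski.backgroundOn U) Φ) ≤ ENNReal.ofReal ε ∧ (∀ x : ↥U, x.1 0 = τ → (∀ j, R j - 1 ≤ Kerr.radius (a j) (poincareInv (mo j).1 (mo j).2 x.1)) → 𝒟.timeOrientation.IsFutureDirected (mfderiv 𝓘(ℝ, E4) (𝓡 4) Φ x (E4.basisVector 0)))) → ∀ z : E4, z 0 = τ → (∀ l, r₀ l < Kerr.radius (a l) (poincareInv (mo l).1 (mo l).2 z)) → ∀ ρ : ℝ, ρ₀ ≤ ρ → (∀ l, ρ ≤ Kerr.radius (a l) (poincareInv (mo l).1 (mo l).2 z)) → ∀ m ≤ k, ‖iteratedFDeriv ℝ m (𝒟.toSpacetime.deviationExtend (Minkowski.backgroundOn U) Φ) z‖ ≤ ε + C / ρ :=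
  -- LANDED p156224 (wave 2)
  Summit.FinalStateConjecture.FinalStateConjecture.Theorems.KerrnessPropagates.KerrBasinCapture.stub_farFieldFlatness

/-- stub C1 — A FLAT PRECONNECTED PATH TO THE FAR ZONE: for a configuration in the margins (strict recession
`v₀ > 0`) and `ρ₁ > 0`, beyond a lab time `T`: from every point `z` of `{x⁰ = τ}` with all radii `≥ ρ₁` there is a
preconnected `S ∋ z` inside `{x⁰ = τ, all radii ≥ ρ₁}` containing a point `z₂` with `rᵢ(z₂) ≥ Rᵢ` for all `i`
(any prescribed `R`). Proof idea: `S` = segment 1 (rest-frame radially outward from the lab-nearest hole `l`: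
the lab segment `s ↦ Λₗ(t(s), (1+s) y̲) + cₗ`, along which `rₗ` increases and the other holes stay `≳ v₀τ/2`
away) ∪ segment 2 (a ray from its endpoint in a direction dodging the `N` lab balls `B(Xᵢ(τ), ρ̄)`,
`ρ̄ = √2 L₀ √(ρ₁² + a²)`, supplied by the landed `stub_directionDodging` with `D = 32(N+1)ρ̄`; along it all radii
stay `≥ ρ₁` and tend to `∞`). Segments are preconnected and share a point (`IsPreconnected.union`). Lab/radius
comparisons: `le_radius_of_le_norm_spatial_sub`, `norm_spatial_sub_le`, `sub_le_norm_centre_sub`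
(…Theorems.KerrnessPropagates.KerrBasinCapture, file …StubLargeNearZones). -/
theorem stub_flatPathExists : ∀ (N₀ : ℕ) (m₀ χ μ v₀ L₀ : ℝ), 0 < m₀ → χ < 1 → 0 < μ → 0 < v₀ → ∀ (N : ℕ) (M a r₀ : Fin N → ℝ) (mo : Fin N → ↥lorentzGroup × E4), (N ≤ N₀ ∧ (∀ i, m₀ ≤ M i ∧ M i ≤ m₀⁻¹ ∧ |a i| ≤ χ * M i ∧ Kerr.rMinus (M i) (a i) + μ ≤ r₀ i ∧ r₀ i + μ ≤ Kerr.rPlus (M i) (a i) ∧ ∀ v : E4, ‖((mo i).1 : E4 ≃L[ℝ] E4) v‖ ≤ L₀ * ‖v‖) ∧ (∀ i j, i ≠ j → v₀ ≤ ‖(((mo i).1 : E4 ≃L[ℝ] E4) (E4.basisVector 0) 0)⁻¹ • E4.spatial (((mo i).1 : E4 ≃L[ℝ] E4) (E4.basisVector 0)) - (((mo j).1 : E4 ≃L[ℝ] E4) (E4.basisVector 0) 0)⁻¹ • E4.spatial (((mo j).1 : E4 ≃L[ℝ] E4) (E4.basisVector 0))‖)) → ∀ ρ₁ : ℝ, 0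 < ρ₁ → ∃ T : ℝ, ∀ τ : ℝ, T ≤ τ → ∀ (R : Fin N → ℝ) (z : E4), z 0 = τ → (∀ i, ρ₁ ≤ Kerr.radius (a i) (poincareInv (mo i).1 (mo i).2 z)) → ∃ S : Set E4, IsPreconnected S ∧ z ∈ S ∧ (∀ x ∈ S, x 0 = τ ∧ ∀ i, ρ₁ ≤ Kerr.radius (a i) (poincareInv (mo i).1 (mo i).2 x)) ∧ ∃ z₂ ∈ S, ∀ i, R i ≤ Kerr.radius (a i) (poincareInv (mo i).1 (mo i).2 z₂) :=
  -- LANDED p157304 (wave 2)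
  Summit.FinalStateConjecture.FinalStateConjecture.Theorems.KerrnessPropagates.KerrBasinCapture.stub_flatPathExists

/-- stub C2 — ORIENTATION TRANSPORT ALONG A FLAT PRECONNECTED SET: in a hand-over slab, if a preconnected
`S ⊆ {x⁰ = τ} ∖ inner discs` (hence `S ⊆ U`) has `‖deviationExtend (Minkowski.backgroundOn U) Φ‖ < 1` on `S`
and contains a point `z₂` of the far zone (`Rⱼ − 1 ≤ rⱼ(z₂)`, where the slab hypothesis says `Φ_*∂₀` is
future-directed), then `Φ_*∂₀` is future-directed at every point of `S`. Proof idea: `W := {y ∈ U | ‖dev y‖ < 1}`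
is open (continuity of `deviationExtend` on `U`) and contains `S`; apply
`Spacetime.isFutureDirected_mfderiv_basisVector_zero_of_isPreconnected_of_contMDiffOn`
(Literature/Geometry/Lorentzian/BackgroundChartCalculusLocal.lean). -/
theorem stub_orientationTransport : ∀ k : ℕ, ∀ (X : Type) [TopologicalSpace X] [ChartedSpace E3 X] [IsManifold (𝓡 3) (⊤ : ℕ∞) X] [T2Space X] [SecondCountableTopology X] [ConnectedSpace X] (D : InitialDataSet (𝓡 3) X) (𝒟 : VacuumCauchyDevelopment D) (N : ℕ) (M a r₀ : Fin N → ℝ) (mo : Fin N → ↥lorentzGroup × E4) (ε τ : ℝ) (R : Fin N → ℝ) (U : Opens E4) (Φ : U → 𝒟.carrier), ((∀ i, r₀ i + 1 ≤ R i) ∧ ContMDiff 𝓘(ℝ, E4) (𝓡 4) (⊤ : ℕ∞) Φ ∧ Topology.IsOpenEmbedding Φ ∧ {x : E4 | x 0 = τ ∧ (∀ j, r₀ j < Kerr.radius (a j) (poincareInv (mo j).1 (mo j).2 x))} ⊆ (U : Set E4) ∧ range Φ ⊆ 𝒟.metric.causalFuture 𝒟.timeOrientation (range 𝒟.embed) ∧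 𝒟.metric.IsAchronal 𝒟.timeOrientation (Φ '' {x : ↥U | (x : E4) 0 = τ}) ∧ (∀ i, supCkENorm {x : E4 | x 0 = τ ∧ (∀ j, r₀ j < Kerr.radius (a j) (poincareInv (mo j).1 (mo j).2 x)) ∧ Kerr.radius (a i) (poincareInv (mo i).1 (mo i).2 x) ≤ R i} k (𝒟.toSpacetime.deviationExtend ⟨U, boostedKerrBilin (mo i).1 (mo i).2 (M i) (a i), fun x ↦ x 0, fun x ↦ Kerr.radius (a i) (poincareInv (mo i).1 (mo i).2 x)⟩ Φ) ≤ ENNReal.ofReal ε) ∧ supCkENorm {x : E4 | x 0 = τ ∧ (∀ j, r₀ j < Kerr.radius (a j) (poincareInv (mo j).1 (mo j).2 x)) ∧ ∀ j, R j - 1 ≤ Kerr.radius (a j) (poincareInv (mo j).1 (mo j).2 x)} k (𝒟.toSpacetime.deviationExtend (Minkowski.backgroundOn U) Φ) ≤ ENNReal.ofReal ε ∧ (∀ x : ↥U, x.1 0 = τ → (∀ j, R j - 1 ≤ Kerr.radius (a j) (poincareInv (mo j).1 (mo j).2 x.1)) → 𝒟.timeOrientation.IsFutureDirected (mfderiv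 𝓘(ℝ, E4) (𝓡 4) Φ x (E4.basisVector 0)))) → ∀ S : Set E4, IsPreconnected S → S ⊆ {x : E4 | x 0 = τ ∧ ∀ j, r₀ j < Kerr.radius (a j) (poincareInv (mo j).1 (mo j).2 x)} → (∀ x ∈ S, ‖𝒟.toSpacetime.deviationExtend (Minkowski.backgroundOn U) Φ x‖ < 1) → (∃ z₂ ∈ S, ∀ j, R j - 1 ≤ Kerr.radius (a j) (poincareInv (mo j).1 (mo j).2 z₂)) → ∀ x : ↥U, x.1 ∈ S → 𝒟.timeOrientation.IsFutureDirected (mfderiv 𝓘(ℝ, E4) (𝓡 4) Φ x (E4.basisVector 0)) :=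
  -- LANDED p156814 (wave 2)
  Summit.FinalStateConjecture.FinalStateConjecture.Theorems.KerrnessPropagates.KerrBasinCapture.stub_orientationTransport

/-- stub A — THE GLOBAL RE-ANCHORING MAP EXISTS (static, pure `E4` geometry): given `N` pairs of motions
`(Λₙⱼ, cₙⱼ)`, `(Λₗⱼ, cₗⱼ)` with boosts `δ`-close in operator norm (norms `≤ L₀`), lab positions at lab time `τ`
`δϱ`-close, and limit lab positions pairwise `≥ 16ϱ` apart (`ϱ ≥ 1`), there is a smooth `Θ : E4 → E4`
preserving the time coordinate, `η`-close to the identity in `C¹` with all higher jets `≤ η` and displacement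
`≤ ηϱ` on the slab `{|x⁰ − τ| < 1}`, an open embedding there, which on the lab ball of radius `ϱ` about the `j`-th
limit position IS the affine re-gauging `Θⱼ = Pₙⱼ ∘ Sⱼ ∘ Pₗⱼ⁻¹` (`Sⱼ` a rest-frame time shear): `DΘ = Λₙⱼ ∘ Tⱼ`,
`poincareInv Λₙⱼ cₙⱼ (Θ x) = Tⱼ (x − cₗⱼ) + βⱼ e₀`, with frame map `Tⱼ = (I + e₀ ⊗ φⱼ) Λₗⱼ⁻¹`, `‖Tⱼ − Λₗⱼ⁻¹‖ ≤ η`,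
`Tⱼ (Λₗⱼ e₀) ∈ ℝ e₀`. Proof idea: the affine algebra is prototyped sorry-free in the lead's
work/proto/ReanchorAffine.lean (`reanchor`, `frameMap`, `reanchor_apply_zero`, `fderiv_reanchor`,
`poincareInv_reanchor`, `frameMap_apply_sub`, `frameMap_apply_lorentz_basisVector`,
`bilinPullback_reanchor_boostedKerrBilin`); glue `Θ = x + Σⱼ ψⱼ(x̲)(Θⱼ x − x)` with
`ψⱼ(x) = Real.smoothTransition (4 − ‖x̲ − Xₗⱼ‖²/ϱ²)` (≡ 1 on the ball of radius `√3 ϱ ⊇ B(ϱ)`, supported in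
`B(2ϱ)`, pairwise disjoint supports), jets of `ψⱼ` `O(ϱ^{-m})` (`norm_iteratedFDeriv_comp_le`), Leibniz
(`norm_iteratedFDeriv_smul_le`) with `Θⱼ x − x = (DΘⱼ − I)(x − x̂ⱼ) + dⱼ`, `‖DΘⱼ − I‖ ≤ C L₀² δ`, `|dⱼ| ≤ δϱ`;
injectivity/open embedding from `‖DΘ − I‖ ≤ 1/2` on the convex slab (`Convex.lipschitzOnWith_of_nnnorm_hasFDerivWithin_le`,
`ApproximatesLinearOn.toOpenPartialHomeomorph`). -/
theorem stub_reanchorMapExists : ∀ (k N : ℕ) (L₀ η : ℝ), 1 ≤ L₀ → 0 < η → ∃ δ : ℝ, 0 < δ ∧ ∀ (Λn Λl : Fin N → ↥lorentzGroup) (cn cl : Fin N → E4) (τ ϱ : ℝ), 1 ≤ ϱ → (∀ j, ‖(((Λl j : ↥lorentzGroup) : E4 ≃L[ℝ] E4) : E4 →L[ℝ] E4)‖ ≤ L₀ ∧ ‖((((Λl j : ↥lorentzGroup) : E4 ≃L[ℝ] E4)).symm : E4 →L[ℝ] E4)‖ ≤ L₀ ∧ ‖(((Λn j : ↥lorentzGroup)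 : E4 ≃L[ℝ] E4) : E4 →L[ℝ] E4)‖ ≤ L₀ ∧ ‖(((Λn j : ↥lorentzGroup) : E4 ≃L[ℝ] E4) : E4 →L[ℝ] E4) - (((Λl j : ↥lorentzGroup) : E4 ≃L[ℝ] E4) : E4 →L[ℝ] E4)‖ ≤ δ) → (∀ j, ‖(E4.spatial (cn j) + ((τ) - (cn j) 0) • (((((Λn j : ↥lorentzGroup) : E4 ≃L[ℝ] E4)) (E4.basisVector 0) 0)⁻¹ • E4.spatial ((((Λn j : ↥lorentzGroup) : E4 ≃L[ℝ] E4)) (E4.basisVector 0)))) - (E4.spatial (cl j) + ((τ) - (cl j) 0) • (((((Λl j : ↥lorentzGroup) : E4 ≃L[ℝ] E4)) (E4.basisVector 0) 0)⁻¹ • E4.spatial ((((Λl j : ↥lorentzGroup) : E4 ≃L[ℝ] E4)) (E4.basisVector 0))))‖ ≤ δ * ϱ) → (∀ i j, i ≠ j → 16 * ϱ ≤ ‖(E4.spatial (cl i) + ((τ) - (cl i) 0) • (((((Λl i : ↥lorentzGroup) : E4 ≃L[ℝ] E4)) (E4.basisVector 0) 0)⁻¹ • E4.spatial ((((Λl i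 : ↥lorentzGroup) : E4 ≃L[ℝ] E4)) (E4.basisVector 0)))) - (E4.spatial (cl j) + ((τ) - (cl j) 0) • (((((Λl j : ↥lorentzGroup) : E4 ≃L[ℝ] E4)) (E4.basisVector 0) 0)⁻¹ • E4.spatial ((((Λl j : ↥lorentzGroup) : E4 ≃L[ℝ] E4)) (E4.basisVector 0))))‖) → ∃ (Θ : E4 → E4) (T : Fin N → E4 →L[ℝ] E4) (β : Fin N → ℝ), ContDiff ℝ (⊤ : ℕ∞) Θ ∧ (∀ x, (Θ x) 0 = x 0) ∧ (∀ x : E4, |x 0 - τ| < 1 → ‖fderiv ℝ Θ x - ContinuousLinearMap.id ℝ E4‖ ≤ η ∧ ‖Θ x - x‖ ≤ η * ϱ ∧ ∀ m : ℕ, 2 ≤ m → m ≤ k + 1 → ‖iteratedFDeriv ℝ m Θ x‖ ≤ η) ∧ Topology.IsOpenEmbedding ({x : E4 | |x 0 - τ| < 1}.restrict Θ) ∧ (∀ j, ‖T j - ((((Λl j : ↥lorentzGroup) : E4 ≃L[ℝ] E4)).symm : E4 →L[ℝ] E4)‖ ≤ η ∧ (∃ κ : ℝ, T j (((Λl j :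 ↥lorentzGroup) : E4 ≃L[ℝ] E4) (E4.basisVector 0)) = κ • E4.basisVector 0) ∧ ∀ x : E4, |x 0 - τ| < 1 → ‖E4.spatial x - (E4.spatial (cl j) + ((τ) - (cl j) 0) • (((((Λl j : ↥lorentzGroup) : E4 ≃L[ℝ] E4)) (E4.basisVector 0) 0)⁻¹ • E4.spatial ((((Λl j : ↥lorentzGroup) : E4 ≃L[ℝ] E4)) (E4.basisVector 0))))‖ ≤ ϱ → fderiv ℝ Θ x = (((Λn j : ↥lorentzGroup) : E4 ≃L[ℝ] E4) : E4 →L[ℝ] E4).comp (T j) ∧ poincareInv (Λn j) (cn j) (Θ x) = T j (x - cl j) + β j • E4.basisVector 0) :=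
  -- LANDED p159821 (wave 2)
  Summit.FinalStateConjecture.FinalStateConjecture.Theorems.KerrnessPropagates.KerrBasinCapture.stub_reanchorMapExists

/-- stub A' — THE GLOBAL RE-ANCHORING MAP WITH THE CANONICAL SHEAR FRAME: as `stub_reanchorMapExists` (landed p159821,
whose construction it is), but the per-hole frame map is the EXPLICIT `Tⱼ = (I + e₀ ⊗ κₙⱼ⁻¹(λₗⱼ − λₙⱼ)) ∘ Λₗⱼ⁻¹`
(`λ = E4.dx 0 ∘ Λ`, `κₙⱼ = (Λₙⱼ e₀)⁰`), i.e. the prototype's `frameMap`: `fderiv Θ x = Λₙⱼ ∘ Tⱼ` and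
`poincareInv Λₙⱼ cₙⱼ (Θ x) = Tⱼ (x − cₗⱼ) + βⱼ e₀` on the `j`-th exact ball. Proof = the landed file's construction
(its `rme_*` per-hole lemmas are stated for exactly this `T`, `L`, `w` as variables with defining equations). -/
theorem stub_reanchorMapShear : ∀ (k N : ℕ) (L₀ η : ℝ), 1 ≤ L₀ → 0 < η → ∃ δ : ℝ, 0 < δ ∧ ∀ (Λn Λl : Fin N → ↥lorentzGroup) (cn cl : Fin N → E4) (τ ϱ : ℝ), 1 ≤ ϱ → (∀ j, ‖(((Λl j : ↥lorentzGroup) : E4 ≃L[ℝ] E4) : E4 →L[ℝ] E4)‖ ≤ L₀ ∧ ‖((((Λl j : ↥lorentzGroup) : E4 ≃L[ℝ] E4)).symm : E4 →L[ℝ] E4)‖ ≤ L₀ ∧ ‖(((Λn j : ↥lorentzGroup) : E4 ≃L[ℝ] E4) : E4 →L[ℝ] E4)‖ ≤ L₀ ∧ ‖(((Λn j : ↥lorentzGroup) : E4 ≃L[ℝ] E4) : E4 →L[ℝ] E4) - (((Λl j : ↥lorentzGroup) : E4 ≃L[ℝ] E4) : E4 →L[ℝ] E4)‖ ≤ δ)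 → (∀ j, ‖(E4.spatial (cn j) + ((τ) - (cn j) 0) • (((((Λn j : ↥lorentzGroup) : E4 ≃L[ℝ] E4)) (E4.basisVector 0) 0)⁻¹ • E4.spatial ((((Λn j : ↥lorentzGroup) : E4 ≃L[ℝ] E4)) (E4.basisVector 0)))) - (E4.spatial (cl j) + ((τ) - (cl j) 0) • (((((Λl j : ↥lorentzGroup) : E4 ≃L[ℝ] E4)) (E4.basisVector 0) 0)⁻¹ • E4.spatial ((((Λl j : ↥lorentzGroup) : E4 ≃L[ℝ] E4)) (E4.basisVector 0))))‖ ≤ δ * ϱ) → (∀ i j, i ≠ j → 16 * ϱ ≤ ‖(E4.spatial (cl i) + ((τ) - (cl i) 0) • (((((Λl i : ↥lorentzGroup) : E4 ≃L[ℝ] E4)) (E4.basisVector 0) 0)⁻¹ • E4.spatial ((((Λl i : ↥lorentzGroup) : E4 ≃L[ℝ] E4)) (E4.basisVector 0)))) - (E4.spatial (cl j) + ((τ) - (cl j) 0) • (((((Λl j : ↥lorentzGroup) : E4 ≃L[ℝ] E4)) (E4.basisVector 0) 0)⁻¹ • E4.spatial ((((Λl j : ↥lorentzGroup) : E4 ≃L[ℝ]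 E4)) (E4.basisVector 0))))‖) → ∃ (Θ : E4 → E4) (β : Fin N → ℝ), ContDiff ℝ (⊤ : ℕ∞) Θ ∧ (∀ x, (Θ x) 0 = x 0) ∧ (∀ x : E4, |x 0 - τ| < 1 → ‖fderiv ℝ Θ x - ContinuousLinearMap.id ℝ E4‖ ≤ η ∧ ‖Θ x - x‖ ≤ η * ϱ ∧ ∀ m : ℕ, 2 ≤ m → m ≤ k + 1 → ‖iteratedFDeriv ℝ m Θ x‖ ≤ η) ∧ Topology.IsOpenEmbedding ({x : E4 | |x 0 - τ| < 1}.restrict Θ) ∧ (∀ j, ∀ x : E4, |x 0 - τ| < 1 → ‖E4.spatial x - (E4.spatial (cl j) + ((τ) - (cl j) 0) • (((((Λl j : ↥lorentzGroup) : E4 ≃L[ℝ] E4)) (E4.basisVector 0) 0)⁻¹ • E4.spatial ((((Λl j : ↥lorentzGroup) : E4 ≃L[ℝ] E4)) (E4.basisVector 0))))‖ ≤ ϱ → fderiv ℝ Θ x = (((Λn j : ↥lorentzGroup) : E4 ≃L[ℝ] E4) : E4 →L[ℝ] E4).comp ((ContinuousLinearMap.id ℝ E4 + (((((Λn j : ↥lorentzGroup)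 : E4 ≃L[ℝ] E4) (E4.basisVector 0)) 0)⁻¹ • ((E4.dx 0).comp (((Λl j : ↥lorentzGroup) : E4 ≃L[ℝ] E4) : E4 →L[ℝ] E4) - (E4.dx 0).comp (((Λn j : ↥lorentzGroup) : E4 ≃L[ℝ] E4) : E4 →L[ℝ] E4))).smulRight (E4.basisVector 0)).comp ((((Λl j : ↥lorentzGroup) : E4 ≃L[ℝ] E4)).symm : E4 →L[ℝ] E4)) ∧ poincareInv (Λn j) (cn j) (Θ x) = ((ContinuousLinearMap.id ℝ E4 + (((((Λn j : ↥lorentzGroup) : E4 ≃L[ℝ] E4) (E4.basisVector 0)) 0)⁻¹ • ((E4.dx 0).comp (((Λl j : ↥lorentzGroup) : E4 ≃L[ℝ] E4) : E4 →L[ℝ] E4) - (E4.dx 0).comp (((Λn j : ↥lorentzGroup) : E4 ≃L[ℝ] E4) : E4 →L[ℝ] E4))).smulRight (E4.basisVector 0)).comp ((((Λl j : ↥lorentzGroup) : E4 ≃L[ℝ] E4)).symm : E4 →L[ℝ] E4)) (x - cl j) + β j • E4.basisVector 0) :=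
  -- LANDED p161280 (wave 3)
  Summit.FinalStateConjecture.FinalStateConjecture.Theorems.KerrnessPropagates.KerrBasinCapture.stub_reanchorMapShear

/-- stub P-struct — THE TRANSFERRED CHART: given the hypothesis chart `Φ : U → 𝒟` (smooth open embedding covering the `n`-th
slab, image in `J⁺(ιΣ)`, achronal slab image), a smooth time-preserving `Θ : E4 → E4` which is an open embedding on
`{|x⁰ − τ| < 1}` and maps the limit slab into the `n`-th slab (radius bookkeeping, a hypothesis here), the chart
`Φ ∘ θ` on `U' := {|x⁰−τ|<1} ∩ Θ⁻¹U ∩ {rₗ > r₀ₗ}` (`θ` the corestriction of `Θ`) is a smooth open embedding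
(`IsOpenEmbedding.of_comp` through `Subtype.val`), covers the limit slab, has image in `J⁺(ιΣ)` and achronal slab image
(sub-image: `Θ` preserves `x⁰`; achronality is antitone), satisfies the chain rule `d(Φ∘θ)ₓ v = dΦ_{Θx}(DΘₓ v)`, and its
deviation from ANY reference form `B'` is, near each point of `U'`, the `Θ`-pullback (`bilinPullback`) of `dev_B Φ + B` minus `B'`
(pointwise algebra on the open set `U'`: `deviationExtend_coe`, `Spacetime.deviation_apply`, `pullbackBilin_apply`,
`mfderiv_comp`). Generic chart-precomposition facts may be landed first under Literature/Geometry/Lorentzian/. -/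
theorem stub_transferChart : ∀ k : ℕ, ∀ (X : Type) [TopologicalSpace X] [ChartedSpace E3 X] [IsManifold (𝓡 3) (⊤ : ℕ∞) X] [T2Space X] [SecondCountableTopology X] [ConnectedSpace X] (D : InitialDataSet (𝓡 3) X) (𝒟 : VacuumCauchyDevelopment D) (N : ℕ) (aₙ r₀ₙ : Fin N → ℝ) (moₙ : Fin N → ↥lorentzGroup × E4) (aₗ r₀ₗ : Fin N → ℝ) (moₗ : Fin N → ↥lorentzGroup × E4) (τ : ℝ) (U : Opens E4) (Φ : U → 𝒟.carrier) (Θ : E4 → E4), ContMDiff 𝓘(ℝ, E4) (𝓡 4) (⊤ : ℕ∞) Φ → Topology.IsOpenEmbedding Φ → {x : E4 | x 0 = τ ∧ ∀ j, r₀ₙ j < Kerr.radius (aₙ j) (poincareInv (moₙ j).1 (moₙ j).2 x)} ⊆ (U : Set E4) → range Φ ⊆ 𝒟.metric.causalFuture 𝒟.timeOrientation (range 𝒟.embed) → 𝒟.metric.IsAchronal 𝒟.timeOrientation (Φ '' {x : ↥U | (x : E4) 0 = τ}) → ContDiff ℝ (⊤ : ℕ∞) Θ → (∀ x, (Θ x)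 0 = x 0) → Topology.IsOpenEmbedding ({x : E4 | |x 0 - τ| < 1}.restrict Θ) → (∀ x : E4, x 0 = τ → (∀ j, r₀ₗ j < Kerr.radius (aₗ j) (poincareInv (moₗ j).1 (moₗ j).2 x)) → ∀ j, r₀ₙ j < Kerr.radius (aₙ j) (poincareInv (moₙ j).1 (moₙ j).2 (Θ x))) → ∃ (U' : Opens E4) (θ : U' → U), (U' : Set E4) = {x : E4 | |x 0 - τ| < 1} ∩ Θ ⁻¹' (U : Set E4) ∩ {x : E4 | ∀ j, r₀ₗ j < Kerr.radius (aₗ j) (poincareInv (moₗ j).1 (moₗ j).2 x)} ∧ (∀ x : U', ((θ x : U) : E4) = Θ x) ∧ ContMDiff 𝓘(ℝ, E4) (𝓡 4) (⊤ : ℕ∞) (Φ ∘ θ) ∧ Topology.IsOpenEmbedding (Φ ∘ θ) ∧ {x : E4 | x 0 = τ ∧ ∀ j, r₀ₗ j < Kerr.radius (aₗ j) (poincareInv (moₗ j).1 (moₗ j).2 x)} ⊆ (U' : Set E4) ∧ range (Φ ∘ θ) ⊆ 𝒟.metric.causalFuture 𝒟.timeOrientation (range 𝒟.embed) ∧ 𝒟.metric.IsAchronal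 𝒟.timeOrientation ((Φ ∘ θ) '' {x : ↥U' | (x : E4) 0 = τ}) ∧ (∀ x : U', ∀ v : E4, mfderiv 𝓘(ℝ, E4) (𝓡 4) (Φ ∘ θ) x v = mfderiv 𝓘(ℝ, E4) (𝓡 4) Φ (θ x) (fderiv ℝ Θ x v)) ∧ (∀ (Bg Bg' : E4 → E4 →L[ℝ] E4 →L[ℝ] ℝ) (tm tm' rd rd' : E4 → ℝ) (x : U'), 𝒟.toSpacetime.deviationExtend ⟨U', Bg', tm', rd'⟩ (Φ ∘ θ) =ᶠ[𝓝 (x : E4)] fun y ↦ bilinPullback Θ (fun z ↦ 𝒟.toSpacetime.deviationExtend ⟨U, Bg, tm, rd⟩ Φ z + Bg z) y - Bg' y) :=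
  -- LANDED p161991 (wave 3)
  Summit.FinalStateConjecture.FinalStateConjecture.Theorems.KerrnessPropagates.KerrBasinCapture.stub_transferChart

/-- stub (anchor) — ACCURACY MONOTONICITY OF THE HAND-OVER SLAB: `SlabAt … ε τ → SlabAt … ε' τ` for `ε ≤ ε'`
(`ENNReal.ofReal` is monotone). A genuine (tiny) lemma of the assembly (its `N = 0` case), registered so that the line's
DEFINITIONS file `Theorems/KerrnessPropagatesKerrBasinCaptureDefs.lean` — which proves it — can be landed
`--supports` this crux (every Theorems proposal must prove a registered stub; registered signatures are capped at
4000 characters, which is why the two remaining analytic stubs are re-registered over those definitions). -/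
theorem stub_slabAtMono : ∀ k : ℕ, ∀ (X : Type) [TopologicalSpace X] [ChartedSpace E3 X] [IsManifold (𝓡 3) (⊤ : ℕ∞) X] [T2Space X] [SecondCountableTopology X] [ConnectedSpace X] (D : InitialDataSet (𝓡 3) X) (𝒟 : VacuumCauchyDevelopment D) (N : ℕ) (M a r₀ : Fin N → ℝ) (mo : Fin N → ↥lorentzGroup × E4) (ε ε' τ : ℝ), ε ≤ ε' → (∃ (R : Fin N → ℝ) (U : Opens E4) (Φ : U → 𝒟.carrier), (∀ i, r₀ i + 1 ≤ R i) ∧ ContMDiff 𝓘(ℝ, E4) (𝓡 4) (⊤ : ℕ∞) Φ ∧ Topology.IsOpenEmbedding Φ ∧ {x : E4 | x 0 = τ ∧ (∀ j, r₀ j < Kerr.radius (a j) (poincareInv (mo j).1 (mo j).2 x))} ⊆ (U : Set E4) ∧ range Φ ⊆ 𝒟.metric.causalFuture 𝒟.timeOrientation (range 𝒟.embed) ∧ 𝒟.metric.IsAchronal 𝒟.timeOrientation (Φ '' {x : ↥U | (x : E4) 0 = τ}) ∧ (∀ i, supCkENorm {x : E4 | x 0 = τ ∧ (∀ j, r₀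 j < Kerr.radius (a j) (poincareInv (mo j).1 (mo j).2 x)) ∧ Kerr.radius (a i) (poincareInv (mo i).1 (mo i).2 x) ≤ R i} k (𝒟.toSpacetime.deviationExtend ⟨U, boostedKerrBilin (mo i).1 (mo i).2 (M i) (a i), fun x ↦ x 0, fun x ↦ Kerr.radius (a i) (poincareInv (mo i).1 (mo i).2 x)⟩ Φ) ≤ ENNReal.ofReal ε) ∧ supCkENorm {x : E4 | x 0 = τ ∧ (∀ j, r₀ j < Kerr.radius (a j) (poincareInv (mo j).1 (mo j).2 x)) ∧ ∀ j, R j - 1 ≤ Kerr.radius (a j) (poincareInv (mo j).1 (mo j).2 x)} k (𝒟.toSpacetime.deviationExtend (Minkowski.backgroundOn U) Φ) ≤ ENNReal.ofReal ε ∧ (∀ x : ↥U, x.1 0 = τ → (∀ j, R j - 1 ≤ Kerr.radius (a j) (poincareInv (mo j).1 (mo j).2 x.1)) → 𝒟.timeOrientation.IsFutureDirected (mfderiv 𝓘(ℝ, E4) (𝓡 4) Φ x (E4.basisVector 0)))) → ∃ (R : Fin N → ℝ) (U : Opens E4) (Φ : U → 𝒟.carrier), (∀ i, r₀ i + 1 ≤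 R i) ∧ ContMDiff 𝓘(ℝ, E4) (𝓡 4) (⊤ : ℕ∞) Φ ∧ Topology.IsOpenEmbedding Φ ∧ {x : E4 | x 0 = τ ∧ (∀ j, r₀ j < Kerr.radius (a j) (poincareInv (mo j).1 (mo j).2 x))} ⊆ (U : Set E4) ∧ range Φ ⊆ 𝒟.metric.causalFuture 𝒟.timeOrientation (range 𝒟.embed) ∧ 𝒟.metric.IsAchronal 𝒟.timeOrientation (Φ '' {x : ↥U | (x : E4) 0 = τ}) ∧ (∀ i, supCkENorm {x : E4 | x 0 = τ ∧ (∀ j, r₀ j < Kerr.radius (a j) (poincareInv (mo j).1 (mo j).2 x)) ∧ Kerr.radius (a i) (poincareInv (mo i).1 (mo i).2 x) ≤ R i} k (𝒟.toSpacetime.deviationExtend ⟨U, boostedKerrBilin (mo i).1 (mo i).2 (M i) (a i), fun x ↦ x 0, fun x ↦ Kerr.radius (a i) (poincareInv (mo i).1 (mo i).2 x)⟩ Φ) ≤ ENNReal.ofReal ε') ∧ supCkENorm {x : E4 | x 0 = τ ∧ (∀ j, r₀ j < Kerr.radius (a j) (poincareInv (mo j).1 (mo j).2 x)) ∧ ∀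 j, R j - 1 ≤ Kerr.radius (a j) (poincareInv (mo j).1 (mo j).2 x)} k (𝒟.toSpacetime.deviationExtend (Minkowski.backgroundOn U) Φ) ≤ ENNReal.ofReal ε' ∧ (∀ x : ↥U, x.1 0 = τ → (∀ j, R j - 1 ≤ Kerr.radius (a j) (poincareInv (mo j).1 (mo j).2 x.1)) → 𝒟.timeOrientation.IsFutureDirected (mfderiv 𝓘(ℝ, E4) (𝓡 4) Φ x (E4.basisVector 0))) :=
  -- LANDED with the line's definitions file (p165579)
  Summit.FinalStateConjecture.FinalStateConjecture.Theorems.KerrnessPropagates.KerrBasinCapture.stub_slabAtMono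

/-- stub AtTime — SLAB TRANSFER FOR TWO FIXED CONFIGURATIONS AT A FIXED LAB TIME: the analytic heart of the
assembly (radius bookkeeping, the transferred chart, near jets by the affine re-gauging + the family-continuity bound, far jets
by the near-identity pullback of far-field flatness, orientation by path transport + same-cone comparison), with every
constant and every smallness/largeness relation an explicit hypothesis (no sequences). Stated by the assembly worker (files
work/stubs/stub_slabTransferAtTime.lean + stub_slabTransferCore3.lean, both sorry-free), registered verbatim. -/
theorem stub_slabTransferAtTime : ∀ k : ℕ, ∀ (X : Type) [TopologicalSpace X] [ChartedSpace E3 X] [IsManifold (𝓡 3) (⊤ : ℕ∞) X] [T2Space X] [SecondCountableTopology X] [ConnectedSpace X] (D : InitialDataSet (𝓡 3) X) (𝒟 : VacuumCauchyDevelopment D) (N : ℕ) (μ A : ℝ) (Mₙ aₙ r₀ₙ : Fin N → ℝ) (moₙ : Fin N → ↥lorentzGroup × E4) (Mₗ aₗ r₀ₗ : Fin N → ℝ) (moₗ : Fin N → ↥lorentzGroup × E4) (τ ε ε' Rb ϱ η δc f₀ : ℝ) (Θ : E4 → E4) (β : Fin N → ℝ) (T : Fin N → E4 →L[ℝ] E4)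 (φ : Fin N → E4 →L[ℝ] ℝ) (Xₙ Xₗ : Fin N → E3) (R : Fin N → ℝ) (U : Opens E4) (Φ : U → 𝒟.carrier), 0 < μ → 0 ≤ A → 2 ≤ Rb → (∀ i, μ ≤ r₀ₙ i ∧ r₀ₙ i + μ / 4 ≤ r₀ₗ i ∧ r₀ₙ i + 2 ≤ Rb ∧ r₀ₗ i + 2 ≤ Rb ∧ |aₙ i| ≤ A ∧ |aₗ i| ≤ A) → (∀ i (y : E4), μ ≤ Kerr.radius (aₗ i) y → |Kerr.radius (aₙ i) y - Kerr.radius (aₗ i) y| ≤ min (μ / 8) 1) → 2 * (Rb + A + 3) ≤ ϱ → 0 < ε → 0 ≤ η → η ≤ 1 / 8 → 0 ≤ f₀ → f₀ ≤ 1 / 8 → 4 ^ k * (k.factorial : ℝ) * 2 ^ (k + 2) * ε + δc ≤ ε' → 4 ^ k * (k.factorial : ℝ) * 2 ^ (k + 2) * f₀ + 2 ^ (k + 2) * ‖Minkowski.bilin‖ * η ≤ ε' → (∀ j, Xₙ j = E4.spatial (moₙ j).2 + (τ - (moₙ j).2 0) • ((((moₙ j).1 : E4 ≃L[ℝ] E4)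 (E4.basisVector 0) 0)⁻¹ • E4.spatial (((moₙ j).1 : E4 ≃L[ℝ] E4) (E4.basisVector 0)))) → (∀ j, Xₗ j = E4.spatial (moₗ j).2 + (τ - (moₗ j).2 0) • ((((moₗ j).1 : E4 ≃L[ℝ] E4) (E4.basisVector 0) 0)⁻¹ • E4.spatial (((moₗ j).1 : E4 ≃L[ℝ] E4) (E4.basisVector 0)))) → (∀ j, ‖Xₙ j - Xₗ j‖ ≤ ϱ / 8) → (∀ j, T j = (ContinuousLinearMap.id ℝ E4 + (φ j).smulRight (E4.basisVector 0)).comp ((((moₗ j).1 : E4 ≃L[ℝ] E4).symm : E4 →L[ℝ] E4))) → ContDiff ℝ (⊤ : ℕ∞) Θ → (∀ x, (Θ x) 0 = x 0) → (∀ x : E4, |x 0 - τ| < 1 → ‖fderiv ℝ Θ x - ContinuousLinearMap.id ℝ E4‖ ≤ η ∧ ‖Θ x - x‖ ≤ η * ϱ ∧ ∀ m : ℕ, 2 ≤ m → m ≤ k + 1 → ‖iteratedFDeriv ℝ m Θ x‖ ≤ η) → Topology.IsOpenEmbedding ({x : E4 | |x 0 - τ| < 1}.restrict Θ) → (∀ j,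 ∀ x : E4, |x 0 - τ| < 1 → ‖E4.spatial x - Xₗ j‖ ≤ ϱ → fderiv ℝ Θ x = (((moₙ j).1 : E4 ≃L[ℝ] E4) : E4 →L[ℝ] E4).comp (T j) ∧ poincareInv (moₙ j).1 (moₙ j).2 (Θ x) = T j (x - (moₗ j).2) + β j • E4.basisVector 0) → (∀ j, ∀ i ≤ k, ∀ x : E4, μ ≤ Kerr.radius (aₗ j) (poincareInv (moₗ j).1 (moₗ j).2 x) → Kerr.radius (aₗ j) (poincareInv (moₗ j).1 (moₗ j).2 x) ≤ Rb + 1 → ‖iteratedFDeriv ℝ i (fun z ↦ (ContinuousLinearMap.precomp ℝ (T j)).comp ((Kerr.bilin (Mₙ j) (aₙ j) (T j (z - (moₗ j).2))).comp (T j))) x - iteratedFDeriv ℝ i (boostedKerrBilin (moₗ j).1 (moₗ j).2 (Mₗ j) (aₗ j)) x‖ ≤ δc) → SlabWith k 𝒟 N Mₙ aₙ r₀ₙ moₙ ε τ R U Φ → (∀ j, Rb + 3 ≤ R j) → (∀ z : E4, z 0 = τ → (∀ l, r₀ₙ l < Kerr.radius (aₙ l) (poincareInv (moₙ l).1 (moₙ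 l).2 z)) → (∀ l, Rb - 1 ≤ Kerr.radius (aₙ l) (poincareInv (moₙ l).1 (moₙ l).2 z)) → ∀ m ≤ k, ‖iteratedFDeriv ℝ m (𝒟.toSpacetime.deviationExtend (Minkowski.backgroundOn U) Φ) z‖ ≤ f₀) → (∀ z : E4, z 0 = τ → (∀ i, Rb - 1 ≤ Kerr.radius (aₙ i) (poincareInv (moₙ i).1 (moₙ i).2 z)) → ∃ S : Set E4, IsPreconnected S ∧ z ∈ S ∧ (∀ x ∈ S, x 0 = τ ∧ ∀ i, Rb - 1 ≤ Kerr.radius (aₙ i) (poincareInv (moₙ i).1 (moₙ i).2 x)) ∧ ∃ z₂ ∈ S, ∀ i, R i ≤ Kerr.radius (aₙ i) (poincareInv (moₙ i).1 (moₙ i).2 z₂)) → SlabAt k 𝒟 N Mₗ aₗ r₀ₗ moₗ ε' τ :=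
  -- LANDED p167113 (rev 10)
  Summit.FinalStateConjecture.FinalStateConjecture.Theorems.KerrnessPropagates.KerrBasinCapture.stub_slabTransferAtTime

/-- stub Final (rev 10) — SLAB TRANSFER TO THE LIMIT CONFIGURATION (`= SlabTransfer`, stated through the line's tree
definitions so that the registered signature fits the gate's 4000-char cap): proved in the lead's folder
(work/stubs/final/stub_slabTransferFinal.lean = the assembly `slabTransferCore3_expanded` fed with the ten landed pieces
A', P-struct, G, B|G, C1, C2, A, T2a, T2b, T2c, and the fixed-time transfer `stub_slabTransferAtTime`). -/
theorem stub_slabTransferFinal : ∀ k : ℕ, ∀ (X : Type) [TopologicalSpace X] [ChartedSpace E3 X] [IsManifold (𝓡 3) (⊤ : ℕ∞) X] [T2Space X] [SecondCountableTopology X] [ConnectedSpace X] (D : InitialDataSet (𝓡 3) X) (𝒟 : VacuumCauchyDevelopment D) (N₀ : ℕ) (m₀ χ μ v₀ L₀ : ℝ), 0 < m₀ → χ < 1 → 0 < μ → 0 < v₀ → ∀ (N : ℕ) (M a r₀ : ℕ → Fin N → ℝ) (mo : ℕ → Fin N → ↥lorentzGroup × E4) (Mₗ aₗ rₗ r₀ₗ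 : Fin N → ℝ) (moₗ : Fin N → ↥lorentzGroup × E4), (∀ n, InMargins N₀ m₀ χ μ v₀ L₀ N (M n) (a n) (r₀ n) (mo n)) → (∀ i, Tendsto (fun n ↦ M n i) atTop (𝓝 (Mₗ i))) → (∀ i, Tendsto (fun n ↦ a n i) atTop (𝓝 (aₗ i))) → (∀ i, Tendsto (fun n ↦ r₀ n i) atTop (𝓝 (rₗ i))) → (∀ i, Tendsto (fun n ↦ (((mo n i).1 : E4 ≃L[ℝ] E4) : E4 →L[ℝ] E4)) atTop (𝓝 (((moₗ i).1 : E4 ≃L[ℝ] E4) : E4 →L[ℝ] E4))) → (∀ i, Tendsto (fun n ↦ (((mo n i).1 : E4 ≃L[ℝ] E4).symm : E4 →L[ℝ] E4)) atTop (𝓝 (((moₗ i).1 : E4 ≃L[ℝ] E4).symm : E4 →L[ℝ] E4))) → InMargins N₀ m₀ χ μ v₀ L₀ N Mₗ aₗ rₗ moₗ → (∀ i, r₀ₗ i = rₗ i + μ / 2) → ∀ ε' : ℝ, 0 < ε' → ∃ (n₀ : ℕ) (ε₀ : ℝ), 0 < ε₀ ∧ ∀ n, n₀ ≤ n → ∃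 T : ℝ, ∀ τ : ℝ, T ≤ τ → ∀ ε : ℝ, 0 < ε → ε ≤ ε₀ → SlabAt k 𝒟 N (M n) (a n) (r₀ n) (mo n) ε τ → SlabAt k 𝒟 N Mₗ aₗ r₀ₗ moₗ ε' τ :=
  -- LANDED p167971 (rev 10): the whole pointwise leg of the line is in the tree
  Summit.FinalStateConjecture.FinalStateConjecture.Theorems.KerrnessPropagates.KerrBasinCapture.stub_slabTransferFinal

/-! Consistency (elaborated, not kept): each expanded stub statement is, by `δ`-unfolding, the named
proposition the composition consumes; and the blocks ARE the crux's conjuncts. -/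
example : Goal.stub_weakCosmicCensorshipTame := stub_weakCosmicCensorshipTame
example : Goal.stub_recurrenceAlongCensoredCurves := stub_recurrenceAlongCensoredCurves
example : Goal.stub_interiorLemmaAlongRecurrentCurves := stub_interiorLemmaAlongRecurrentCurves
/-- `TameOmegaCapture` is tame genericity of `OmegaCaptured k` (definitional). -/
example : TameOmegaCapture ↔ ∀ k : ℕ, ∀ (X : Type) [TopologicalSpace X] [ChartedSpace E3 X] [IsManifold (𝓡 3) (⊤ : ℕ∞) X] [T2Space X] [SecondCountableTopology X] [ConnectedSpace X], InitialDataSet.IsTameChristodoulouGeneric (admissibleVacuumData X) (OmegaCaptured k) 1 :=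
  Iff.rfl
example : Goal.stub_marginCompactness := stub_marginCompactness
example : Goal.stub_largeNearZones := stub_largeNearZones
example : Goal.stub_directionDodging := stub_directionDodging
example : Goal.stub_kerrFamilyContinuity := stub_kerrFamilyContinuity
example : Goal.stub_uniformBoostedKerrDecay := stub_uniformBoostedKerrDecay
example : Goal.stub_farFieldFlatness := stub_farFieldFlatness
example : Goal.stub_flatPathExists := stub_flatPathExists
example : Goal.stub_orientationTransport := stub_orientationTransport
example : Goal.stub_reanchorMapExists := stub_reanchorMapExists
example : Goal.stub_reanchorMapShear := stub_reanchorMapShear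
example : Goal.stub_transferChart := stub_transferChart
example : Goal.stub_slabTransferAtTime := stub_slabTransferAtTime
example : Goal.stub_slabAtMono := stub_slabAtMono
example : Goal.stub_slabTransferFinal := stub_slabTransferFinal

/-- The crux, restated through the blocks (definitional; checks that `FixedRecurrence` and
`InteriorLemma` are its conjuncts verbatim). -/
example : Summit.FinalStateConjecture.FinalStateConjecture.Theses.KerrnessPropagates.KerrBasinCapture ↔
    ∀ k : ℕ, ∀ (X : Type) [TopologicalSpace X] [ChartedSpace E3 X] [IsManifold (𝓡 3) (⊤ : ℕ∞) X] [T2Space X] [SecondCountableTopology X] [ConnectedSpace X], InitialDataSet.IsTameChristodoulouGeneric (admissibleVacuumData X) (fun D ↦ ∀ 𝒟 : VacuumCauchyDevelopment D, 𝒟.IsMaximal → Summit.FinalStateConjecture.HasCompleteNullInfinity 𝒟.toCauchyDevelopment ∧ FixedRecurrence k 𝒟 ∧ InteriorLemma 𝒟) 1 :=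
  Iff.rfl

/-! ## The composition (kernel-checked; no `sorry` of its own) -/

section Glue

variable {k : ℕ} {X : Type} [TopologicalSpace X] [ChartedSpace E3 X] [IsManifold (𝓡 3) (⊤ : ℕ∞) X]
  [ConnectedSpace X] {D : InitialDataSet (𝓡 3) X} {𝒟 : VacuumCauchyDevelopment D}

/-- Recurrence at accuracy `1/(m+1)` of a configuration packaged in the `Σ`-type (glue-only). -/
def RecSig (k : ℕ) (𝒟 : VacuumCauchyDevelopment D) (m : ℕ) (p : Σ N : ℕ, (Fin N → ℝ) × (Fin N → ℝ) × (Fin N → ℝ) × (Fin N → ↥lorentzGroup × E4)) : Prop :=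
  ∀ τ₁ : ℝ, ∃ τ : ℝ, τ₁ ≤ τ ∧ SlabAt k 𝒟 p.1 p.2.1 p.2.2.1 p.2.2.2.1 p.2.2.2.2 (1 / ((m : ℝ) + 1)) τ

/-- Margins of a configuration packaged in the `Σ`-type (glue-only). -/
def MargSig (N₀ : ℕ) (m₀ χ μ v₀ L₀ : ℝ) (p : Σ N : ℕ, (Fin N → ℝ) × (Fin N → ℝ) × (Fin N → ℝ) × (Fin N → ↥lorentzGroup × E4)) : Prop :=
  InMargins N₀ m₀ χ μ v₀ L₀ p.1 p.2.1 p.2.2.1 p.2.2.2.1 p.2.2.2.2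

end Glue

/-- CHARGE STABILISATION (the birth skeleton's pointwise stub, now a theorem of this file modulo the
registered stubs T1, T2a–c, T2-core): floating recurrence with margins ⇒ recurrence to ONE fixed
sub-extremal configuration with inner radii in `(r₋, r₊)`. -/
theorem chargeStabilisation_of : ChargeStabilisation := by
  intro k X _ _ _ _ _ _ D 𝒟 hfloat
  -- EVERY piece of the pointwise leg has landed (waves 1–3 + rev 10): T1 and the slab transfer are tree theorems
  have hT1 : MarginCompactness := stub_marginCompactness
  have hT2 : SlabTransfer := stub_slabTransferFinal
  obtain ⟨N₀, m₀, χ, μ, v₀, L₀, hm₀, hχ, hμ, hv₀, hε⟩ := hfloat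
  have hpos : ∀ n : ℕ, (0 : ℝ) < 1 / ((n : ℝ) + 1) := fun n ↦ by positivity
  choose Nf Mf af rf mof hmarg hrec using fun n : ℕ ↦ hε (1 / ((n : ℝ) + 1)) (hpos n)
  obtain ⟨N, M, a, r₀, mo, φ, Mₗ, aₗ, rₗ, moₗ, hφ, hs, hM, ha, hr, hΛ, hΛs, hmargₗ⟩ :=
    hT1 N₀ m₀ χ μ v₀ L₀ (fun n ↦ ⟨Nf n, Mf n, af n, rf n, mof n⟩) (fun n ↦ hmarg n)
  -- transport margins and recurrence along the Σ-equalities `hs`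
  have hmargN : ∀ n, InMargins N₀ m₀ χ μ v₀ L₀ N (M n) (a n) (r₀ n) (mo n) := by
    intro n
    have h1 : MargSig N₀ m₀ χ μ v₀ L₀ ⟨Nf (φ n), Mf (φ n), af (φ n), rf (φ n), mof (φ n)⟩ := hmarg (φ n)
    have h2 : (⟨Nf (φ n), Mf (φ n), af (φ n), rf (φ n), mof (φ n)⟩ : Σ N : ℕ, (Fin N → ℝ) × (Fin N → ℝ) × (Fin N → ℝ) × (Fin N → ↥lorentzGroup × E4)) = ⟨N, M n, a n, r₀ n, mo n⟩ :=
      hs n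
    rw [h2] at h1
    exact h1
  have hrecN : ∀ n, ∀ τ₁ : ℝ, ∃ τ : ℝ, τ₁ ≤ τ ∧
      SlabAt k 𝒟 N (M n) (a n) (r₀ n) (mo n) (1 / ((φ n : ℝ) + 1)) τ := by
    intro n
    have h1 : RecSig k 𝒟 (φ n) ⟨Nf (φ n), Mf (φ n), af (φ n), rf (φ n), mof (φ n)⟩ := hrec (φ n)
    have h2 : (⟨Nf (φ n), Mf (φ n), af (φ n), rf (φ n), mof (φ n)⟩ : Σ N : ℕ, (Fin N → ℝ) × (Fin N → ℝ) × (Fin N → ℝ) × (Fin N → ↥lorentzGroup × E4)) = ⟨N, M n, a n, r₀ n, mo n⟩ :=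
      hs n
    rw [h2] at h1
    exact h1
  have hlim := hmargₗ.2.1
  refine ⟨N, Mₗ, aₗ, fun i ↦ rₗ i + μ / 2, moₗ, fun i ↦ ?_, fun ε' hε' τ₁ ↦ ?_⟩
  · obtain ⟨h1, -, h3, h4, h5, -⟩ := hlim i
    have hMpos : 0 < Mₗ i := hm₀.trans_le h1
    refine ⟨?_, ?_, ?_⟩
    · show |aₗ i| < Mₗ i
      calc |aₗ i| ≤ χ * Mₗ i := h3
        _ < 1 * Mₗ i := mul_lt_mul_of_pos_right hχ hMpos
        _ = Mₗ i := one_mul _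
    · show Kerr.rMinus (Mₗ i) (aₗ i) < rₗ i + μ / 2
      linarith
    · show rₗ i + μ / 2 < Kerr.rPlus (Mₗ i) (aₗ i)
      linarith
  · obtain ⟨n₀, ε₀, hε₀, hstep⟩ := hT2 k X D 𝒟 N₀ m₀ χ μ v₀ L₀ hm₀ hχ hμ hv₀ N M a r₀ mo Mₗ aₗ rₗ
      (fun i ↦ rₗ i + μ / 2) moₗ hmargN hM ha hr hΛ hΛs hmargₗ (fun _ ↦ rfl) ε' hε'
    -- an index `n ≥ n₀` whose accuracy `1/(φ n + 1)` is below `ε₀`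
    obtain ⟨m, hm⟩ := exists_nat_gt (1 / ε₀)
    set n : ℕ := max n₀ m with hn_def
    have hn₀ : n₀ ≤ n := le_max_left _ _
    have hφn : (m : ℝ) ≤ (φ n : ℝ) := by
      exact_mod_cast (le_max_right n₀ m).trans (hφ.id_le n)
    have hacc : 1 / ((φ n : ℝ) + 1) ≤ ε₀ := by
      rw [div_le_iff₀ (by positivity)]
      have : 1 / ε₀ < (φ n : ℝ) + 1 := by linarith
      have h' : 1 < ε₀ * ((φ n : ℝ) + 1) := by
        have := (div_lt_iff₀ hε₀).1 this
        linarith [this]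
      linarith
    obtain ⟨T, hT⟩ := hstep n hn₀
    obtain ⟨τ, hτ, hslab⟩ := hrecN n (max τ₁ T)
    exact ⟨τ, (le_max_left _ _).trans hτ,
      hT τ ((le_max_right _ _).trans hτ) _ (hpos _) hacc hslab⟩

/-- Every admissible datum has a sole Dafermos–Rodnianski-flat end (so constant curves are tame). -/
theorem admissible_hasEnd {X : Type} [TopologicalSpace X] [ChartedSpace E3 X] [IsManifold (𝓡 3) (⊤ : ℕ∞) X] :
    ∀ d ∈ admissibleVacuumData X, ∃ e : AFEnd X, e.IsSoleEnd ∧ ∃ M : ℝ, e.IsStronglyAsymptoticallyFlatDR d M :=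
  fun _ hd ↦ exists_isSoleEnd_of_mem_admissibleVacuumData hd

/-- Rev 13 — TAME GENERICITY OF `P₁ k` (censored and recurrent) from stubs 1 and 2a, by COMPOSITION ALONG CURVES
(`isTameChristodoulouGeneric_of_relative_exceptional`). -/
theorem censoredRecurrent_generic (hW : Goal.stub_weakCosmicCensorshipTame) (hR : Goal.stub_recurrenceAlongCensoredCurves)
    (k : ℕ) (X : Type) [TopologicalSpace X] [ChartedSpace E3 X] [IsManifold (𝓡 3) (⊤ : ℕ∞) X] [T2Space X]
    [SecondCountableTopology X] [ConnectedSpace X] :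
    InitialDataSet.IsTameChristodoulouGeneric (admissibleVacuumData X) (CensoredRecurrent k) 1 :=
  InitialDataSet.isTameChristodoulouGeneric_of_relative_exceptional admissible_hasEnd (hW X)
    (fun e F hF hdich hadm hQ hexc ↦ hR k X e F hF hdich hadm hQ hexc)

/-- Rev 13 — GENERIC ω-LIMIT CAPTURE FROM THE THREE REGISTERED STUBS: tame weak cosmic censorship (stub 1, the shared
open item stmt-FinalStateConjecture-17269), recurrence along censored curves (stub 2a) and the interior lemma along
recurrent curves (stub 2b) give tame genericity of `Q_k` by two compositions along curves
(`isTameChristodoulouGeneric_of_relative_exceptional`): through an exceptional admissible datum pass the constant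
curve or the curve the previous genericity provides, and take the curve the next stub hands back. -/
theorem tameOmegaCapture_of :
    Goal.stub_weakCosmicCensorshipTame → Goal.stub_recurrenceAlongCensoredCurves →
      Goal.stub_interiorLemmaAlongRecurrentCurves → TameOmegaCapture := by
  intro hW hR hI k X _ _ _ _ _ _
  exact InitialDataSet.isTameChristodoulouGeneric_of_relative_exceptional admissible_hasEnd
    (censoredRecurrent_generic hW hR k X) (fun e F hF hdich hadm hQ hexc ↦ hI k X e F hF hdich hadm hQ hexc)

/-- Rev 13 — rev 12's second stub from stubs 1, 2a, 2b (capture along censored curves). -/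
theorem captureAlongCensoredCurves_of :
    Goal.stub_weakCosmicCensorshipTame → Goal.stub_recurrenceAlongCensoredCurves →
      Goal.stub_interiorLemmaAlongRecurrentCurves → CaptureAlongCensoredCurves := by
  intro hW hR hI k X _ _ _ _ _ _ e F hF hdich hadm hQ hexc
  exact InitialDataSet.exists_curve_of_isTameChristodoulouGeneric_of_not (tameOmegaCapture_of hW hR hI k X)
    e F hF hdich hadm hQ hexc

/-- Rev 13 — THE CUT LOSES NOTHING, stub 2b is necessary: generic ω-limit capture hands back `Q_k`-curves through every
`Q_k`-exceptional base datum, whatever the incoming curve (`exists_curve_of_isTameChristodoulouGeneric_of_not`). -/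
theorem interiorLemmaAlongRecurrentCurves_of_tameOmegaCapture :
    TameOmegaCapture → Goal.stub_interiorLemmaAlongRecurrentCurves := by
  intro hT k X _ _ _ _ _ _ e F hF hdich hadm hQ hexc
  exact InitialDataSet.exists_curve_of_isTameChristodoulouGeneric_of_not (hT k X) e F hF hdich hadm hQ hexc

/-- Rev 13 — THE CUT LOSES NOTHING, stub 2a is necessary: generic ω-limit capture gives tame genericity of `P₁ k` by
monotonicity (forget the interior lemma), which hands back `P₁ k`-curves through every `P₁ k`-exceptional base datum.
Together with `weakCosmicCensorshipTame_of_kerrBasinCapture` (Theorems, p172189: generic ω-limit capture and the route's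
MGHD item give stub 1) this shows stubs 1 ∧ 2a ∧ 2b ⟺ the birth skeleton's single stub, modulo the route's own item
`MaximalDevelopmentExists`. -/
theorem recurrenceAlongCensoredCurves_of_tameOmegaCapture :
    TameOmegaCapture → Goal.stub_recurrenceAlongCensoredCurves := by
  intro hT k X _ _ _ _ _ _ e F hF hdich hadm hQ hexc
  have h1 : InitialDataSet.IsTameChristodoulouGeneric (admissibleVacuumData X) (CensoredRecurrent k) 1 :=
    (hT k X).mono fun D _ hD 𝒟 h𝒟 ↦ ⟨(hD 𝒟 h𝒟).1, (hD 𝒟 h𝒟).2.1⟩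
  exact InitialDataSet.exists_curve_of_isTameChristodoulouGeneric_of_not h1 e F hF hdich hadm hQ hexc

/-- THE CRUX BY NAME from the registered stubs: tame Christodoulou genericity (codimension 1 in
the admissible class) is monotone in the property — the witness pair `(e, F)` through an exceptional
datum is reused verbatim — and, pointwise in the datum and the development, charge stabilisation
(`chargeStabilisation_of`, from T1 + T2a–c + T2-core, all LANDED) turns floating recurrence with margins into
recurrence to one fixed configuration, the other two conjuncts (complete `𝓘⁺`, interior lemma) being carried
unchanged; generic ω-limit capture itself is `tameOmegaCapture_of` (rev 13: tame weak cosmic censorship,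
recurrence along censored curves, the interior lemma along recurrent curves — composed along curves). -/
theorem KerrBasinCapture_of :
    Goal.stub_weakCosmicCensorshipTame → Goal.stub_recurrenceAlongCensoredCurves →
      Goal.stub_interiorLemmaAlongRecurrentCurves →
      Summit.FinalStateConjecture.FinalStateConjecture.Theses.KerrnessPropagates.KerrBasinCapture := by
  intro hW hR hI k X _ _ _ _ _ _
  have hA : TameOmegaCapture := tameOmegaCapture_of hW hR hI
  have hB : ChargeStabilisation := chargeStabilisation_of
  -- tame Christodoulou genericity is monotone in the property
  refine InitialDataSet.IsTameChristodoulouGeneric.mono (hA k X) ?_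
  intro D hD hQ 𝒟 h𝒟
  exact ⟨(hQ 𝒟 h𝒟).1, hB k X D 𝒟 (hQ 𝒟 h𝒟).2.1, (hQ 𝒟 h𝒟).2.2⟩

end Summit.FinalStateConjecture.FinalStateConjecture.Cruxes.KerrBasinCapture.Birth
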